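import Literature.Probability.RandomPlanarGeometry.SAWFisherTransformation
import Mathlib.Analysis.SpecialFunctions.Log.Basic
import HarnessLib

/-!
# The martini lattice `ℍ̃` and its connective constant: `μ(ℍ̃)⁻³ + μ(ℍ̃)⁻⁴ = μ(ℍ)⁻²`

Grimmett–Li, *Self-avoiding walks and the Fisher transformation* (Electron. J. Combin. 20 (2013)
P47), Theorem 3(a): "Let `G` be an infinite, connected, bipartite graph with vertex-sets coloured
black and white, and suppose that the coloured graph `G` is quasi-transitive, and every black vertex
has degree 3. Let `G̃` be obtained by applying the Fisher transformation at each black vertex.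
(a) The connective constants `μ` and `μ̃` of `G` and `G̃` satisfy `μ⁻² = h(μ̃⁻¹)` where
`h(x) = x³ + x⁴`." For `G = ℍ` (honeycomb, `hvGraph`) the graph `G̃` is the martini lattice
(Ding–Fu–Guo–Deng 2012, §II and eq. (9): `1/μ³ + 1/μ⁴ = 1 - √2/2 = 1/(2+√2)`), and
`μ(ℍ) = √(2+√2)` (Duminil-Copin–Smirnov, proved in the tree).

This file proves, for the concrete model `martiniGraph : SimpleGraph (ℤ × ℤ × Option (Fin 3))`
(`(a,b,none)` = the white vertex `(a,b,false)` of `hvGraph`; `(a,b,some k)` = the corner of the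
triangle replacing the black vertex `(a,b,true)` on its edge towards `HV.port (a,b,true) k`):

* `exists_hasConnectiveConstant_martini : ∃ μM > 0, HasConnectiveConstant martiniGraph μM ∧
  (√(2+√2))⁻¹ ^ 2 = μM⁻¹ ^ 3 + μM⁻¹ ^ 4` — in particular the limit `c_N(v)^{1/N} → μM` exists
  from EVERY start `v` (the printed sense (2.1) of Grimmett–Li; `ℍ̃` is not vertex-transitive, and
  this existence is proved here, not assumed);
* `martini_relation` — the same with the tree's `μ(ℍ)`; `martini_unique`.

Proof (Grimmett–Li §4–§5 in an elementary vertex-list form; all machinery `private`). LOWER bound,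
termwise: a honeycomb walk of length `2n` from a white vertex together with one detour bit per
black vertex lifts injectively to a walk of `ℍ̃` of length `3n + #(long detours)`, whence
`c_N(white) ≥ Σ_{s} c_{2|s|}(ℍ)` over the bit lists `s` with `3|s| + #true = N`, and a third of that
for corner starts; with `x₀³ + x₀⁴ = μ(ℍ)⁻²` the weights `α = μ(ℍ)² x₀³`, `β = μ(ℍ)² x₀⁴` sum to
`1` and the renewal sequence `u_{N+4} = α u_{N+1} + β u_N` stays bounded below, so
`c_N(v) ≥ κ x₀^{-N}`. UPPER bound: good walks (no re-entry into a left cell) from a white vertex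
with honeycomb avoid-sets satisfy a first-unit recursion (`3` or `4` steps per white–black–white
unit, `↔` two honeycomb steps), giving a generating-function domination by the even honeycomb
generating function at `y = x³(1+x)`; re-entries are terminal, so all walks are controlled by good
ones, and corner starts by white starts. The squeeze gives `c_N(v)^{1/N} → 1/x₀` for every `v`.
-/

noncomputable section

open Finset Filter Literature.Probability.LatticeModels
open scoped Topology

namespace Literature.Probability.RandomPlanarGeometry.SAW

/-! ### Ports of the honeycomb lattice (lemmas; `HV.port`, `HV.pidx` are the tree's) -/

namespace HV

/-- `port (port u k) k = u`. [folklore] -/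
private theorem port_port' (u : HV) (k : Fin 3) : port (port u k) k = u := by
  obtain ⟨a, b, c⟩ := u
  cases c <;> fin_cases k <;> simp [port]

/-- A vertex is adjacent to each of its ports. [folklore] -/
private theorem adj_port' (u : HV) (k : Fin 3) : hvGraph.Adj u (port u k) := by
  obtain ⟨a, b, c⟩ := u
  cases c <;> fin_cases k <;> simp [port, hvGraph_adj, AdjRel]

/-- Adjacency is "being a port". [folklore] -/
private theorem adj_iff_exists_port' (u v : HV) : hvGraph.Adj u v ↔ ∃ k, v = port u k := by
  constructor
  · intro h
    obtain ⟨a, b, c⟩ := u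
    obtain ⟨a', b', c'⟩ := v
    rw [hvGraph_adj] at h
    cases c <;> cases c' <;> simp [AdjRel] at h
    · rcases h with ⟨rfl, rfl⟩ | ⟨rfl, rfl⟩ | ⟨rfl, rfl⟩
      · exact ⟨0, by simp [port]⟩
      · exact ⟨1, by simp [port]⟩
      · exact ⟨2, by simp [port]⟩
    · rcases h with ⟨rfl, rfl⟩ | ⟨rfl, rfl⟩ | ⟨rfl, rfl⟩
      · exact ⟨0, by simp [port]⟩
      · exact ⟨1, by simp [port]⟩
      · exact ⟨2, by simp [port]⟩
  · rintro ⟨k, rfl⟩; exact adj_port' u k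

/-- The three ports are distinct. [folklore] -/
private theorem port_injective' (u : HV) : Function.Injective (port u) := by
  obtain ⟨a, b, c⟩ := u
  intro k k' h
  cases c <;> fin_cases k <;> fin_cases k' <;> simp [port] at h ⊢ <;> omega

/-- A port has the other colour. [folklore] -/
private theorem port_colour (u : HV) (k : Fin 3) : (port u k).2.2 = !u.2.2 := by
  obtain ⟨a, b, c⟩ := u
  cases c <;> fin_cases k <;> simp [port]

/-- `port u (pidx u v) = v` for adjacent `u`, `v`. [folklore] -/
private theorem port_pidx' {u v : HV} (h : hvGraph.Adj u v) : port u (pidx u v) = v := by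
  obtain ⟨k, rfl⟩ := (adj_iff_exists_port' u _).1 h
  unfold pidx
  split_ifs with h0 h1
  · exact h0
  · exact h1
  · fin_cases k
    · exact absurd rfl h0
    · exact absurd rfl h1
    · rfl

/-- `pidx u (port u k) = k`. [folklore] -/
private theorem pidx_port' (u : HV) (k : Fin 3) : pidx u (port u k) = k :=
  port_injective' u (port_pidx' (adj_port' u k))

/-- Adjacent vertices have different colours. [folklore] -/
private theorem colour_ne_of_adj {u v : HV} (h : hvGraph.Adj u v) : v.2.2 = !u.2.2 := by
  obtain ⟨k, rfl⟩ := (adj_iff_exists_port' u v).1 h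
  exact port_colour u k

/-- The third port index. [folklore] -/
private def third' (k k' : Fin 3) : Fin 3 := -(k + k')

/-- The third index differs from two distinct ones. [folklore] -/
private theorem third'_ne {k k' : Fin 3} (h : k ≠ k') : third' k k' ≠ k ∧ third' k k' ≠ k' := by
  fin_cases k <;> fin_cases k' <;> simp_all [third'] <;> decide

/-- Adjacent vertices have coordinates differing by at most one (ports). [folklore] -/
private theorem abs_sub_le_one_port (u : HV) (k : Fin 3) :
    |(port u k).1 - u.1| ≤ 1 ∧ |(port u k).2.1 - u.2.1| ≤ 1 := by
  obtain ⟨a, b, c⟩ := u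
  cases c <;> fin_cases k <;> simp [port]

end HV

/-! ### The martini lattice: coordinates `ℤ × ℤ × Option (Fin 3)` -/

/-- Vertex coordinates of the martini lattice: `(a, b, none)` is the white vertex `(a, b, false)` of
`hvGraph`; `(a, b, some k)` is the corner of the triangle replacing the black vertex `(a, b, true)`
on its edge towards `HV.port (a, b, true) k`. [folklore] -/
abbrev MV : Type := ℤ × ℤ × Option (Fin 3)

namespace MV

/-- Adjacency of the martini lattice: the corners of one triangle are pairwise adjacent; corner
`k` of the black cell `(a,b)` is adjacent to the white vertex `HV.port (a,b,true) k`; no white–white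
edges ("`G̃` obtained by applying the Fisher transformation at each black vertex").
[cite: GrimmettLi2013Fisher, Theorem 3] -/
def AdjRel : MV → MV → Prop
  | (a, b, some k), (a', b', some k') => a = a' ∧ b = b' ∧ k ≠ k'
  | (a, b, none), (a', b', some k') => HV.port (a', b', true) k' = (a, b, false)
  | (a, b, some k), (a', b', none) => HV.port (a, b, true) k = (a', b', false)
  | (_, _, none), (_, _, none) => False

/-- Symmetry. [folklore] -/
private theorem adjRel_symm {p q : MV} (h : AdjRel p q) : AdjRel q p := by
  obtain ⟨a, b, s⟩ := p
  obtain ⟨a', b', s'⟩ := q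
  cases s <;> cases s' <;> simp only [AdjRel] at h ⊢
  · exact h
  · exact h
  · exact ⟨h.1.symm, h.2.1.symm, fun e => h.2.2 e.symm⟩

/-- Irreflexivity. [folklore] -/
private theorem adjRel_irrefl (p : MV) : ¬ AdjRel p p := by
  obtain ⟨a, b, s⟩ := p
  cases s <;> simp [AdjRel]

end MV

/-- **The martini lattice `ℍ̃`** = the honeycomb lattice with every black vertex replaced by a
triangle (a definition with a body). [cite: GrimmettLi2013Fisher, Theorem 3] [cite: DingFuGuo2012, §II] -/
def martiniGraph : SimpleGraph MV where
  Adj := MV.AdjRel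
  symm := ⟨fun _ _ h => MV.adjRel_symm h⟩
  loopless := ⟨fun p h => MV.adjRel_irrefl p h⟩

/-- Adjacency of `martiniGraph`, unfolded. [cite: GrimmettLi2013Fisher, Theorem 3] -/
theorem martiniGraph_adj (p q : MV) : martiniGraph.Adj p q ↔ MV.AdjRel p q := Iff.rfl

/-- Adjacency is decidable. [folklore] -/
instance : DecidableRel martiniGraph.Adj := fun p q => by
  obtain ⟨a, b, s⟩ := p
  obtain ⟨a', b', s'⟩ := q
  cases s <;> cases s' <;> simp only [martiniGraph_adj, MV.AdjRel] <;> infer_instance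

/-- The white root `W₀ = (0, 0)`. [folklore] -/
def mW : MV := (0, 0, none)

/-- The corner root `C₀ = ((0,0), corner 0)`. [folklore] -/
def mC : MV := (0, 0, some 0)

namespace MV

/-- The white vertex of `ℍ̃` over the (white) honeycomb vertex `u`. [folklore] -/
def wv (u : HV) : MV := (u.1, u.2.1, none)

/-- The corner `k` of the triangle over the (black) honeycomb vertex `v`. [folklore] -/
def corner (v : HV) (k : Fin 3) : MV := (v.1, v.2.1, some k)

/-- The honeycomb vertex under a martini vertex. [folklore] -/
def hexOf : MV → HV
  | (a, b, none) => (a, b, false)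
  | (a, b, some _) => (a, b, true)

/-- `hexOf (wv u) = u` for white `u`. [folklore] -/
private theorem hexOf_wv {u : HV} (hu : u.2.2 = false) : hexOf (wv u) = u := by
  obtain ⟨a, b, c⟩ := u
  simp only at hu
  subst hu; rfl

/-- `hexOf (corner v k) = v` for black `v`. [folklore] -/
private theorem hexOf_corner {v : HV} (hv : v.2.2 = true) (k : Fin 3) : hexOf (corner v k) = v := by
  obtain ⟨a, b, c⟩ := v
  simp only at hv
  subst hv; rfl

/-- Corners of one triangle with distinct indices are adjacent. [folklore] -/
private theorem adj_corner_corner {v : HV} {k k' : Fin 3} (h : k ≠ k') :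
    martiniGraph.Adj (corner v k) (corner v k') := by
  obtain ⟨a, b, c⟩ := v
  exact ⟨rfl, rfl, h⟩

/-- The corner of black `v` towards its white neighbour `u` is adjacent to `wv u`. [folklore] -/
private theorem adj_corner_wv {v u : HV} (hv : v.2.2 = true) (h : hvGraph.Adj v u) :
    martiniGraph.Adj (corner v (HV.pidx v u)) (wv u) := by
  obtain ⟨a, b, c⟩ := v
  cases c
  · simp at hv
  obtain ⟨x, y, c'⟩ := u
  have hc' : c' = false := by have := HV.colour_ne_of_adj h; simpa using this
  subst hc'
  show HV.port (a, b, true) (HV.pidx (a, b, true) (x, y, false)) = (x, y, false)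
  exact HV.port_pidx' h

/-- `corner` is injective in the index. [folklore] -/
private theorem corner_inj_right {v : HV} {k k' : Fin 3} (h : corner v k = corner v k') : k = k' := by
  simp only [corner, Prod.mk.injEq, Option.some.injEq, true_and] at h; exact h

/-- Adjacent martini vertices have coordinates differing by at most one. [folklore] -/
private theorem abs_sub_le_one_of_adj {p q : MV} (h : martiniGraph.Adj p q) :
    |q.1 - p.1| ≤ 1 ∧ |q.2.1 - p.2.1| ≤ 1 := by
  obtain ⟨a, b, s⟩ := p
  obtain ⟨a', b', s'⟩ := q
  cases s <;> cases s' <;> simp only [martiniGraph_adj, AdjRel] at h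
  · rename_i k'
    have := HV.abs_sub_le_one_port (a', b', true) k'
    rw [h] at this
    simp only at this
    constructor <;> rw [abs_sub_comm] <;> simp [this.1, this.2]
  · rename_i k
    have := HV.abs_sub_le_one_port (a, b, true) k
    rw [h] at this
    simpa using this
  · obtain ⟨rfl, rfl, -⟩ := h; simp

/-! ### Enumeration finsets -/

/-- The box of martini vertices around `p`. [folklore] -/
private def box (p : MV) (n : ℕ) : Finset MV :=
  Icc (p.1 - n) (p.1 + n) ×ˢ (Icc (p.2.1 - n) (p.2.1 + n) ×ˢ univ)

/-- Membership in `box`. [folklore] -/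
private theorem mem_box_iff {p : MV} {n : ℕ} {x : MV} :
    x ∈ box p n ↔ |x.1 - p.1| ≤ n ∧ |x.2.1 - p.2.1| ≤ n := by
  simp only [box, mem_product, mem_Icc, mem_univ, and_true, abs_le]
  omega

/-- A chain of adjacent vertices stays in the box around its head. [folklore] -/
private theorem mem_box_of_isChain :
    ∀ (l : List MV) (p : MV), (p :: l).IsChain martiniGraph.Adj → ∀ x ∈ p :: l, x ∈ box p l.length
  | [], p, _, x, hx => by
    simp only [List.mem_singleton] at hx
    subst hx; simp [mem_box_iff]
  | q :: l, p, h, x, hx => by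
    rw [List.isChain_cons_cons] at h
    rcases List.mem_cons.1 hx with rfl | hx
    · simp only [mem_box_iff, sub_self, abs_zero, List.length_cons, Nat.cast_add, Nat.cast_one]
      constructor <;> positivity
    · have hq := mem_box_of_isChain l q h.2 x hx
      have h1 := abs_sub_le_one_of_adj h.1
      rw [mem_box_iff] at hq ⊢
      simp only [List.length_cons, Nat.cast_add, Nat.cast_one]
      constructor
      · calc |x.1 - p.1| = |(x.1 - q.1) + (q.1 - p.1)| := by ring_nf
          _ ≤ |x.1 - q.1| + |q.1 - p.1| := abs_add_le _ _
          _ ≤ l.length + 1 := by linarith [hq.1, h1.1]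
      · calc |x.2.1 - p.2.1| = |(x.2.1 - q.2.1) + (q.2.1 - p.2.1)| := by ring_nf
          _ ≤ |x.2.1 - q.2.1| + |q.2.1 - p.2.1| := abs_add_le _ _
          _ ≤ l.length + 1 := by linarith [hq.2, h1.2]

/-- The finset of `n`-step self-avoiding lists of `ℍ̃` from `p`. [folklore] -/
def sawFin (p : MV) (n : ℕ) : Finset (List MV) :=
  (listsLen (box p n) (n + 1)).filter fun l => l.IsChain martiniGraph.Adj ∧ l.head? = some p ∧ l.Nodup

/-- `sawFin` enumerates exactly the self-avoiding lists. [folklore] -/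
private theorem mem_sawFin_iff {p : MV} {n : ℕ} {l : List MV} :
    l ∈ sawFin p n ↔ l ∈ sawLists martiniGraph p n := by
  rw [sawFin, mem_filter, mem_listsLen_iff, mem_sawLists_iff]
  constructor
  · rintro ⟨⟨hl, -⟩, hc, hh, hn⟩
    exact ⟨hc, hh, hl, hn⟩
  · rintro ⟨hc, hh, hl, hn⟩
    refine ⟨⟨hl, ?_⟩, hc, hh, hn⟩
    cases l with
    | nil => simp at hl
    | cons q l =>
      simp only [List.head?_cons, Option.some.injEq] at hh
      subst hh
      simp only [List.length_cons, Nat.add_right_cancel_iff] at hl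
      rw [← hl]
      exact mem_box_of_isChain l q hc

/-- `sawFin` as a set is `sawLists`. [folklore] -/
private theorem coe_sawFin (p : MV) (n : ℕ) : (sawFin p n : Set (List MV)) = sawLists martiniGraph p n :=
  Set.ext fun _ => mem_sawFin_iff

/-- The number of self-avoiding lists is the cardinality of `sawFin`. [folklore] -/
private theorem ncard_sawLists_eq_card_sawFin (p : MV) (n : ℕ) :
    (sawLists martiniGraph p n).ncard = #(sawFin p n) := by
  rw [← coe_sawFin, Set.ncard_coe_finset]

/-- `sawCount` of the martini lattice as a finset cardinality. [folklore] -/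
private theorem sawCount_eq_card_sawFin (p : MV) (n : ℕ) : sawCount martiniGraph p n = #(sawFin p n) := by
  rw [sawCount_eq_ncard_sawLists, ncard_sawLists_eq_card_sawFin]

/-! ### Automorphisms: translations and the rotation about the black cell `(0,0)` -/

/-- Translation by `(a, b)`. [folklore] -/
def mshift (a b : ℤ) : martiniGraph ≃g martiniGraph where
  toEquiv :=
    { toFun := fun p => (p.1 + a, p.2.1 + b, p.2.2)
      invFun := fun p => (p.1 - a, p.2.1 - b, p.2.2)
      left_inv := fun p => by simp
      right_inv := fun p => by simp }
  map_rel_iff' := by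
    rintro ⟨x, y, s⟩ ⟨x', y', s'⟩
    cases s <;> cases s' <;> simp only [Equiv.coe_fn_mk, martiniGraph_adj, AdjRel]
    · rename_i k'
      fin_cases k' <;> simp [HV.port] <;> omega
    · rename_i k
      fin_cases k <;> simp [HV.port] <;> omega
    · simp only [add_left_inj]

/-- `mshift` in coordinates. [folklore] -/
@[simp] private theorem mshift_apply (a b : ℤ) (p : MV) : mshift a b p = (p.1 + a, p.2.1 + b, p.2.2) := rfl

/-- The rotation by `2π/3` about the centre of the black triangle `(0,0)`: whites
`(x, y) ↦ (-x-y+1, x)`, corners `((x,y), k) ↦ ((-x-y, x), k+1)`. [folklore] -/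
def mrot : martiniGraph ≃g martiniGraph where
  toEquiv :=
    { toFun := fun p => match p with
        | (x, y, none) => (-x - y + 1, x, none)
        | (x, y, some k) => (-x - y, x, some (k + 1))
      invFun := fun p => match p with
        | (x, y, none) => (y, -x - y + 1, none)
        | (x, y, some k) => (y, -x - y, some (k - 1))
      left_inv := fun p => by
        obtain ⟨x, y, s⟩ := p
        cases s
        · simp; ring
        · simp
      right_inv := fun p => by
        obtain ⟨x, y, s⟩ := p
        cases s
        · simp; ring
        · simp; ring }
  map_rel_iff' := by
    rintro ⟨x, y, s⟩ ⟨x', y', s'⟩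
    cases s <;> cases s' <;> simp only [Equiv.coe_fn_mk, martiniGraph_adj, AdjRel]
    · rename_i k'
      fin_cases k' <;> simp [HV.port] <;> omega
    · rename_i k
      fin_cases k <;> simp [HV.port] <;> omega
    · rename_i k k'
      constructor
      · rintro ⟨h1, h2, h3⟩; exact ⟨h2, by omega, fun e => h3 (by rw [e])⟩
      · rintro ⟨rfl, rfl, h3⟩; exact ⟨rfl, rfl, fun e => h3 (by simpa using e)⟩

/-- `mrot` on corners of the cell `(0,0)`. [folklore] -/
private theorem mrot_corner_zero (k : Fin 3) : mrot (0, 0, some k) = (0, 0, some (k + 1)) := by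
  simp [mrot]

/-- An automorphism taking `p` to one of the two roots. [folklore] -/
private theorem exists_iso_root (p : MV) : ∃ φ : martiniGraph ≃g martiniGraph, φ p = mW ∨ φ p = mC := by
  obtain ⟨x, y, s⟩ := p
  cases s with
  | none => exact ⟨mshift (-x) (-y), Or.inl (by simp [mW])⟩
  | some k =>
    have h0 : mshift (-x) (-y) (x, y, some k) = (0, 0, some k) := by simp
    fin_cases k
    · exact ⟨mshift (-x) (-y), Or.inr (by rw [h0]; rfl)⟩
    · refine ⟨((mshift (-x) (-y)).trans mrot).trans mrot, Or.inr ?_⟩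
      rw [RelIso.trans_apply, RelIso.trans_apply, h0, mrot_corner_zero, mrot_corner_zero]; rfl
    · refine ⟨(mshift (-x) (-y)).trans mrot, Or.inr ?_⟩
      rw [RelIso.trans_apply, h0, mrot_corner_zero]; rfl

/-- Every vertex has the walk counts of one of the two roots. [folklore] -/
private theorem sawCount_eq_root (p : MV) (n : ℕ) :
    sawCount martiniGraph p n = sawCount martiniGraph mW n ∨
      sawCount martiniGraph p n = sawCount martiniGraph mC n := by
  obtain ⟨φ, h | h⟩ := exists_iso_root p
  · left; rw [← h, sawCount_iso]
  · right; rw [← h, sawCount_iso]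

end MV

/-! ### The lift of honeycomb walks (lower bound): white start `v₀`, then for each pair
(black `B`, white `W`) the corners of `B` (entry, [third,] exit) and `wv W` -/

namespace MV

/-- The corners used inside the black triangle `v` entered from `prev` and left towards `next`
(`long`: via the third corner). [folklore] -/
private def blockB (prev v next : HV) (long : Bool) : List MV :=
  if long then [corner v (HV.pidx v prev), corner v (HV.third' (HV.pidx v prev) (HV.pidx v next)),
    corner v (HV.pidx v next)]
  else [corner v (HV.pidx v prev), corner v (HV.pidx v next)]

/-- Lift of the tail `B₁ W₁ B₂ W₂ …` of a honeycomb walk entered from the white vertex `prev`; the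
detour bits are consumed from `s`, one per black vertex. [folklore] -/
private def liftPairs : List Bool → HV → List HV → List MV
  | _, _, [] => []
  | _, prev, [B] => [corner B (HV.pidx B prev)]
  | s, prev, B :: W :: rest => blockB prev B W (s.headD false) ++ wv W :: liftPairs s.tail W rest

/-- **The lift** of a honeycomb walk from a white vertex with detour bits `s`. [folklore] -/
private def lift (s : List Bool) : List HV → List MV
  | [] => []
  | v :: rest => wv v :: liftPairs s v rest

/-- Length of a block. [folklore] -/
private theorem length_blockB (prev v next : HV) (b : Bool) : (blockB prev v next b).length = if b then 3 else 2 := by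
  unfold blockB; split_ifs <;> rfl

/-- Shape of a block: entry corner first, all corners over `v`, exit corner last. [folklore] -/
private theorem blockB_eq_cons (prev v next : HV) (b : Bool) :
    ∃ L, blockB prev v next b = corner v (HV.pidx v prev) :: L ∧ (∀ c ∈ L, ∃ k, c = corner v k) ∧
      (corner v (HV.pidx v prev) :: L).getLast? = some (corner v (HV.pidx v next)) := by
  unfold blockB
  split_ifs
  · exact ⟨_, rfl, by simp, rfl⟩
  · exact ⟨_, rfl, by simp, rfl⟩

/-- `liftPairs` of a nonempty tail starts at the entry corner. [folklore] -/
private theorem liftPairs_eq_cons (s : List Bool) (prev B : HV) (rest : List HV) :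
    ∃ L, liftPairs s prev (B :: rest) = corner B (HV.pidx B prev) :: L := by
  cases rest with
  | nil => exact ⟨[], rfl⟩
  | cons W rest =>
    obtain ⟨L, hL, -, -⟩ := blockB_eq_cons prev B W (s.headD false)
    exact ⟨L ++ wv W :: liftPairs s.tail W rest, by rw [liftPairs, hL, List.cons_append]⟩

/-- Length of the lift of an even tail: three per pair plus the detour bits. [folklore] -/
private theorem length_liftPairs : ∀ (n : ℕ) (s : List Bool) (prev : HV) (rest : List HV),
    rest.length = 2 * n → s.length = n → (liftPairs s prev rest).length = 3 * n + s.count true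
  | 0, s, prev, rest, hr, hs => by
    rw [List.length_eq_zero_iff] at hr hs; subst hr; subst hs; rfl
  | n + 1, s, prev, rest, hr, hs => by
    match rest, s, hr, hs with
    | B :: W :: rest, b :: s, hr, hs =>
      simp only [List.length_cons] at hr hs
      rw [liftPairs, List.length_append, List.length_cons, length_blockB,
        show (b :: s).headD false = b from rfl, show (b :: s).tail = s from rfl,
        length_liftPairs n s W rest (by omega) (by omega), List.count_cons]
      cases b <;> simp <;> omega

/-- Every vertex of `liftPairs s prev rest` lies over a vertex of `rest` (for an alternating tail after
a white `prev`). [folklore] -/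
private theorem hexOf_mem_of_mem_liftPairs : ∀ (rest : List HV) (s : List Bool) (prev : HV),
    (prev :: rest).IsChain hvGraph.Adj → prev.2.2 = false → ∀ c ∈ liftPairs s prev rest, hexOf c ∈ rest
  | [], _, _, _, _, c, hc => by simp [liftPairs] at hc
  | [B], s, prev, hch, hp, c, hc => by
    simp only [liftPairs, List.mem_singleton] at hc
    subst hc
    have hB : B.2.2 = true := by rw [HV.colour_ne_of_adj (List.isChain_cons_cons.1 hch).1, hp]; rfl
    simp [hexOf_corner hB]
  | B :: W :: rest, s, prev, hch, hp, c, hc => by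
    have h1 := (List.isChain_cons_cons.1 hch).1
    have h2 := (List.isChain_cons_cons.1 hch).2
    have hB : B.2.2 = true := by rw [HV.colour_ne_of_adj h1, hp]; rfl
    have hW : W.2.2 = false := by rw [HV.colour_ne_of_adj (List.isChain_cons_cons.1 h2).1, hB]; rfl
    rw [liftPairs, List.mem_append, List.mem_cons] at hc
    rcases hc with hc | rfl | hc
    · obtain ⟨L, hL, hLv, -⟩ := blockB_eq_cons prev B W (s.headD false)
      rw [hL, List.mem_cons] at hc
      rcases hc with rfl | hc
      · simp [hexOf_corner hB]
      · obtain ⟨k, rfl⟩ := hLv c hc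
        simp [hexOf_corner hB]
    · simp [hexOf_wv hW]
    · have := hexOf_mem_of_mem_liftPairs rest s.tail W (List.isChain_cons_cons.1 h2).2 hW c hc
      simp [this]

/-- `liftPairs` of a self-avoiding alternating tail is a self-avoiding chain of `ℍ̃`. [folklore] -/
private theorem liftPairs_chain_nodup : ∀ (rest : List HV) (s : List Bool) (prev B : HV),
    (prev :: B :: rest).IsChain hvGraph.Adj → (prev :: B :: rest).Nodup → prev.2.2 = false →
      (liftPairs s prev (B :: rest)).IsChain martiniGraph.Adj ∧ (liftPairs s prev (B :: rest)).Nodup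
  | [], s, prev, B, _, _, _ => by simp [liftPairs]
  | W :: rest, s, prev, B, hc, hn, hp => by
    have hc1 : hvGraph.Adj prev B := (List.isChain_cons_cons.1 hc).1
    have hc2 : (B :: W :: rest).IsChain hvGraph.Adj := (List.isChain_cons_cons.1 hc).2
    have hBW : hvGraph.Adj B W := (List.isChain_cons_cons.1 hc2).1
    have hc3 : (W :: rest).IsChain hvGraph.Adj := (List.isChain_cons_cons.1 hc2).2
    have hn2 : (B :: W :: rest).Nodup := (List.nodup_cons.1 hn).2
    have hn3 : (W :: rest).Nodup := (List.nodup_cons.1 hn2).2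
    have hB : B.2.2 = true := by rw [HV.colour_ne_of_adj hc1, hp]; rfl
    have hW : W.2.2 = false := by rw [HV.colour_ne_of_adj hBW, hB]; rfl
    have hpW : prev ≠ W := by
      intro h; subst h; exact (List.nodup_cons.1 hn).1 (by simp)
    have hk : HV.pidx B prev ≠ HV.pidx B W := by
      intro h
      have h1 := HV.port_pidx' hc1.symm
      have h2 := HV.port_pidx' hBW
      rw [h] at h1; exact hpW (h1.symm.trans h2)
    have hthird := HV.third'_ne hk
    have hexit : martiniGraph.Adj (corner B (HV.pidx B W)) (wv W) := adj_corner_wv hB hBW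
    have hBnot : B ∉ W :: rest := (List.nodup_cons.1 hn2).1
    -- the recursive part
    have hrec : (wv W :: liftPairs s.tail W rest).IsChain martiniGraph.Adj ∧
        (wv W :: liftPairs s.tail W rest).Nodup := by
      cases rest with
      | nil => simp [liftPairs]
      | cons B' rest =>
        have hWB' : hvGraph.Adj W B' := (List.isChain_cons_cons.1 hc3).1
        have hB' : B'.2.2 = true := by rw [HV.colour_ne_of_adj hWB', hW]; rfl
        obtain ⟨ihc, ihn⟩ := liftPairs_chain_nodup rest s.tail W B' hc3 hn3 hW
        obtain ⟨L, hL⟩ := liftPairs_eq_cons s.tail W B' rest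
        have hentry : martiniGraph.Adj (wv W) (corner B' (HV.pidx B' W)) :=
          (adj_corner_wv hB' hWB'.symm).symm
        rw [hL] at ihc ihn ⊢
        refine ⟨List.IsChain.cons_cons hentry ihc, List.nodup_cons.2 ⟨fun h => ?_, ihn⟩⟩
        have := hexOf_mem_of_mem_liftPairs (B' :: rest) s.tail W hc3 hW (wv W) (by rw [hL]; exact h)
        rw [hexOf_wv hW] at this
        exact (List.nodup_cons.1 hn3).1 this
    -- corners of `B` are not in the recursive part
    have hBL : ∀ k, corner B k ∉ wv W :: liftPairs s.tail W rest := by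
      intro k h
      rcases List.mem_cons.1 h with h | h
      · simp [corner, wv] at h
      · have := hexOf_mem_of_mem_liftPairs rest s.tail W hc3 hW _ h
        rw [hexOf_corner hB] at this
        exact hBnot (List.mem_cons_of_mem _ this)
    rw [liftPairs]
    have h3 : (corner B (HV.pidx B W) :: wv W :: liftPairs s.tail W rest).Nodup :=
      List.nodup_cons.2 ⟨hBL _, hrec.2⟩
    by_cases hb : s.headD false = true
    · rw [hb]
      simp only [blockB, if_true, List.cons_append, List.nil_append]
      refine ⟨List.IsChain.cons_cons (adj_corner_corner hthird.1.symm)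
        (List.IsChain.cons_cons (adj_corner_corner hthird.2) (List.IsChain.cons_cons hexit hrec.1)), ?_⟩
      have h2 : (corner B (HV.third' (HV.pidx B prev) (HV.pidx B W)) :: corner B (HV.pidx B W) ::
          wv W :: liftPairs s.tail W rest).Nodup := by
        refine List.nodup_cons.2 ⟨fun h => ?_, h3⟩
        rcases List.mem_cons.1 h with h | h
        · exact hthird.2 (corner_inj_right h)
        · exact hBL _ h
      refine List.nodup_cons.2 ⟨fun h => ?_, h2⟩
      rcases List.mem_cons.1 h with h | h
      · exact hthird.1 (corner_inj_right h).symm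
      · rcases List.mem_cons.1 h with h | h
        · exact hk (corner_inj_right h)
        · exact hBL _ h
    · rw [Bool.not_eq_true] at hb
      rw [hb]
      simp only [blockB, Bool.false_eq_true, if_false, List.cons_append, List.nil_append]
      refine ⟨List.IsChain.cons_cons (adj_corner_corner hk) (List.IsChain.cons_cons hexit hrec.1), ?_⟩
      refine List.nodup_cons.2 ⟨fun h => ?_, h3⟩
      rcases List.mem_cons.1 h with h | h
      · exact hk (corner_inj_right h)
      · exact hBL _ h

/-- **The lift of a honeycomb self-avoiding walk of even length `2n` from a white vertex `v` with
`n` detour bits `s` is a self-avoiding walk of `ℍ̃` from `wv v` with `3n + #(true bits)` steps.**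
[folklore] -/
private theorem lift_mem_sawLists {s : List Bool} {v : HV} {n : ℕ} {l : List HV} (hv : v.2.2 = false)
    (hl : l ∈ sawLists hvGraph v (2 * n)) (hs : s.length = n) :
    lift s l ∈ sawLists martiniGraph (wv v) (3 * n + s.count true) := by
  obtain ⟨hc, hh, hlen, hn⟩ := hl
  rcases l with _ | ⟨a, rest⟩
  · simp at hlen
  simp only [List.head?_cons, Option.some.injEq] at hh
  subst hh
  simp only [List.length_cons] at hlen
  have hrl : rest.length = 2 * n := by omega
  refine ⟨?_, rfl, by rw [lift, List.length_cons, length_liftPairs n s a rest hrl hs], ?_⟩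
  · rw [lift]
    cases rest with
    | nil => exact List.isChain_singleton _
    | cons B rest =>
      obtain ⟨hc', -⟩ := liftPairs_chain_nodup rest s a B hc hn hv
      obtain ⟨L, hL⟩ := liftPairs_eq_cons s a B rest
      have hB : B.2.2 = true := by rw [HV.colour_ne_of_adj (List.isChain_cons_cons.1 hc).1, hv]; rfl
      rw [hL] at hc' ⊢
      exact List.IsChain.cons_cons (adj_corner_wv hB (List.isChain_cons_cons.1 hc).1.symm).symm hc'
  · rw [lift, List.nodup_cons]
    refine ⟨fun h => ?_, ?_⟩
    · have := hexOf_mem_of_mem_liftPairs rest s a hc hv _ h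
      rw [hexOf_wv hv] at this
      exact (List.nodup_cons.1 hn).1 this
    · cases rest with
      | nil => simp [liftPairs]
      | cons B rest => exact (liftPairs_chain_nodup rest s a B hc hn hv).2

/-- Injectivity of `liftPairs` in the tail and in the bits. [folklore] -/
private theorem liftPairs_inj : ∀ (n : ℕ) (rest rest' : List HV) (s s' : List Bool) (prev : HV),
    rest.length = 2 * n → s.length = n → rest'.length = 2 * s'.length →
    (prev :: rest).IsChain hvGraph.Adj → (prev :: rest).Nodup →
    (prev :: rest').IsChain hvGraph.Adj → (prev :: rest').Nodup → prev.2.2 = false →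
    liftPairs s prev rest = liftPairs s' prev rest' → rest = rest' ∧ s = s'
  | 0, rest, rest', s, s', prev, hr, hs, hr', _, _, _, _, _, h => by
    rw [List.length_eq_zero_iff] at hr hs
    subst hr; subst hs
    match rest', s', hr', h with
    | [], [], _, _ => exact ⟨rfl, rfl⟩
    | [], _ :: _, hr', _ => simp at hr'
    | B' :: rest', s', _, h =>
      obtain ⟨L, hL⟩ := liftPairs_eq_cons s' prev B' rest'
      rw [hL] at h; simp [liftPairs] at h
  | n + 1, rest, rest', s, s', prev, hr, hs, hr', hc, hn, hc', hn', hp, h => by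
    match rest, s, hr, hs with
    | B :: W :: rest, b :: s, hr, hs =>
      simp only [List.length_cons] at hr hs
      match rest', s', hr', h with
      | [], s', hr', h =>
        obtain ⟨L, hL⟩ := liftPairs_eq_cons (b :: s) prev B (W :: rest)
        rw [hL] at h; simp [liftPairs] at h
      | [B'], s', hr', _ => simp at hr'; omega
      | B' :: W' :: rest', [], hr', _ => simp at hr'
      | B' :: W' :: rest', b' :: s', hr', h =>
        simp only [List.length_cons] at hr'
        have hc1 : hvGraph.Adj prev B := (List.isChain_cons_cons.1 hc).1
        have hc2 := (List.isChain_cons_cons.1 hc).2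
        have hBW : hvGraph.Adj B W := (List.isChain_cons_cons.1 hc2).1
        have hc3 := (List.isChain_cons_cons.1 hc2).2
        have hc1' : hvGraph.Adj prev B' := (List.isChain_cons_cons.1 hc').1
        have hc2' := (List.isChain_cons_cons.1 hc').2
        have hBW' : hvGraph.Adj B' W' := (List.isChain_cons_cons.1 hc2').1
        have hc3' := (List.isChain_cons_cons.1 hc2').2
        have hB : B.2.2 = true := by rw [HV.colour_ne_of_adj hc1, hp]; rfl
        have hB' : B'.2.2 = true := by rw [HV.colour_ne_of_adj hc1', hp]; rfl
        have hW : W.2.2 = false := by rw [HV.colour_ne_of_adj hBW, hB]; rfl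
        rw [liftPairs, liftPairs, show (b :: s).headD false = b from rfl, show (b :: s).tail = s from rfl,
          show (b' :: s').headD false = b' from rfl, show (b' :: s').tail = s' from rfl] at h
        -- the entry corners agree, so `B = B'`
        obtain ⟨L₁, h₁, -, hlast₁⟩ := blockB_eq_cons prev B W b
        obtain ⟨L₂, h₂, -, hlast₂⟩ := blockB_eq_cons prev B' W' b'
        have hBB : B = B' := by
          have e := congrArg List.head? h
          rw [h₁, h₂, List.cons_append, List.cons_append, List.head?_cons, List.head?_cons,
            Option.some.injEq] at e
          have e' := congrArg hexOf e
          rwa [hexOf_corner hB, hexOf_corner hB'] at e'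
        subst hBB
        -- the element at index 2 decides the bit: a corner (long) or a white vertex (short)
        have e2 : ∀ (c : Bool) (W₀ : HV) (M : List MV),
            ((blockB prev B W₀ c ++ wv W₀ :: M)[2]?).map (fun q : MV => q.2.2.isSome) = some c := by
          intro c W₀ M; cases c <;> rfl
        have hbb : b = b' := by
          have := congrArg (fun l : List MV => (l[2]?).map (fun q : MV => q.2.2.isSome)) h
          simp only [e2] at this
          exact Option.some.inj this
        subst hbb
        -- the exit corner decides `W`
        have hlen : (blockB prev B W b).length = (blockB prev B W' b).length := by
          rw [length_blockB, length_blockB]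
        have hblk : blockB prev B W b = blockB prev B W' b := List.append_inj_left h hlen
        have hWW : W = W' := by
          have e := congrArg List.getLast? hblk
          rw [h₁, h₂, hlast₁, hlast₂, Option.some.injEq] at e
          rw [← HV.port_pidx' hBW, ← HV.port_pidx' hBW', corner_inj_right e]
        subst hWW
        have htail := List.append_cancel_left h
        rw [List.cons.injEq] at htail
        obtain ⟨hr2, hs2⟩ := liftPairs_inj n rest rest' s s' W (by omega) (by omega) (by omega)
          hc3 (List.nodup_cons.1 (List.nodup_cons.1 hn).2).2 hc3' (List.nodup_cons.1 (List.nodup_cons.1 hn').2).2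
          hW htail.2
        subst hr2; subst hs2
        exact ⟨rfl, rfl⟩

/-- **Injectivity of the lift** on honeycomb self-avoiding walks of even length from a fixed white
vertex, with the right number of detour bits. [folklore] -/
private theorem lift_inj {v : HV} (hv : v.2.2 = false) {s s' : List Bool} {l l' : List HV}
    (hl : l ∈ sawLists hvGraph v (2 * s.length)) (hl' : l' ∈ sawLists hvGraph v (2 * s'.length))
    (h : lift s l = lift s' l') : l = l' ∧ s = s' := by
  obtain ⟨hc, hh, hlen, hn⟩ := hl
  obtain ⟨hc', hh', hlen', hn'⟩ := hl'
  rcases l with _ | ⟨a, rest⟩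
  · simp at hlen
  rcases l' with _ | ⟨a', rest'⟩
  · simp at hlen'
  simp only [List.head?_cons, Option.some.injEq] at hh hh'
  obtain rfl : v = a := hh.symm
  obtain rfl : v = a' := hh'.symm
  simp only [List.length_cons] at hlen hlen'
  rw [lift, lift, List.cons.injEq] at h
  obtain ⟨h1, h2⟩ := liftPairs_inj s.length rest rest' s s' v (by omega) rfl (by omega) hc hn hc' hn' hv h.2
  exact ⟨by rw [h1], h2⟩

end MV

/-- `w_n`: the number of `n`-step self-avoiding walks from a white vertex. [folklore] -/
def wCount (n : ℕ) : ℕ := #(MV.sawFin mW n)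

/-- `k_n`: the number of `n`-step self-avoiding walks from a triangle corner. [folklore] -/
def kCount (n : ℕ) : ℕ := #(MV.sawFin mC n)

/-! ### Compositions of `N` into parts `3` and `4`, and the counting form of the lower bound -/

/-- The bit lists `s` with `3·|s| + #(true bits) = N` (a part `3` per `false`, `4` per `true`),
generated recursively. [folklore] -/
private def comp : ℕ → Finset (List Bool)
  | 0 => {[]}
  | 1 => ∅
  | 2 => ∅
  | 3 => {[false]}
  | N + 4 => (comp (N + 1)).image (List.cons false) ∪ (comp N).image (List.cons true)

/-- Members of `comp N` have total size `N`. [folklore] -/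
private theorem size_of_mem_comp : ∀ (N : ℕ), ∀ s ∈ comp N, 3 * s.length + s.count true = N
  | 0, s, hs => by simp [comp] at hs; subst hs; simp
  | 1, s, hs => by simp [comp] at hs
  | 2, s, hs => by simp [comp] at hs
  | 3, s, hs => by simp [comp] at hs; subst hs; simp
  | N + 4, s, hs => by
    rw [comp, Finset.mem_union, Finset.mem_image, Finset.mem_image] at hs
    rcases hs with ⟨t, ht, rfl⟩ | ⟨t, ht, rfl⟩
    · have := size_of_mem_comp (N + 1) t ht
      simp; omega
    · have := size_of_mem_comp N t ht
      simp; omega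

/-- For a `Bool` list, `#false + #true = length`. [folklore] -/
private theorem count_false_add_count_true (s : List Bool) : s.count false + s.count true = s.length := by
  induction s with
  | nil => simp
  | cons b s ih => cases b <;> simp <;> omega

/-- The renewal weights: `u_N = Σ_{s ∈ comp N} α^{#false} β^{#true}`. [folklore] -/
private def uSeq (α β : ℝ) (N : ℕ) : ℝ := ∑ s ∈ comp N, α ^ s.count false * β ^ s.count true

/-- The renewal recursion `u_{N+4} = α u_{N+1} + β u_N`. [folklore] -/
private theorem uSeq_add_four (α β : ℝ) (N : ℕ) : uSeq α β (N + 4) = α * uSeq α β (N + 1) + β * uSeq α β N := by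
  unfold uSeq
  rw [comp, Finset.sum_union, Finset.sum_image, Finset.sum_image, Finset.mul_sum, Finset.mul_sum]
  · congr 1
    · exact Finset.sum_congr rfl fun s _ => by simp; ring
    · exact Finset.sum_congr rfl fun s _ => by simp; ring
  · intro s _ t _ h; exact List.cons_injective h
  · intro s _ t _ h; exact List.cons_injective h
  · rw [Finset.disjoint_left]
    intro s hs ht
    rw [Finset.mem_image] at hs ht
    obtain ⟨a, -, rfl⟩ := hs
    obtain ⟨b, -, h⟩ := ht
    simp at h

/-- Small values: `u₀ = 1`, `u₃ = α`, `u₄ = β`. [folklore] -/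
private theorem uSeq_small (α β : ℝ) : uSeq α β 0 = 1 ∧ uSeq α β 1 = 0 ∧ uSeq α β 2 = 0 ∧ uSeq α β 3 = α ∧
    uSeq α β 4 = β := by
  refine ⟨by simp [uSeq, comp], by simp [uSeq, comp], by simp [uSeq, comp], by simp [uSeq, comp], ?_⟩
  rw [show (4 : ℕ) = 0 + 4 from rfl, uSeq_add_four]
  simp [uSeq, comp]

/-- `u_N ≥ 0`. [folklore] -/
private theorem uSeq_nonneg {α β : ℝ} (hα : 0 ≤ α) (hβ : 0 ≤ β) (N : ℕ) : 0 ≤ uSeq α β N :=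
  Finset.sum_nonneg fun s _ => by positivity

/-- **The renewal sequence stays bounded below**: if `α, β > 0` and `α + β = 1` then for `N ≥ 6`,
`u_N ≥ δ := min(u₆, u₇, u₈, u₉) > 0`. [folklore] -/
private theorem uSeq_ge {α β : ℝ} (hα : 0 < α) (hβ : 0 < β) (hαβ : α + β = 1) :
    ∃ δ : ℝ, 0 < δ ∧ ∀ N, 6 ≤ N → δ ≤ uSeq α β N := by
  obtain ⟨h0, h1, h2, h3, h4⟩ := uSeq_small α β
  have h5 : uSeq α β 5 = 0 := by rw [show (5 : ℕ) = 1 + 4 from rfl, uSeq_add_four, h2, h1]; ring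
  have h6 : uSeq α β 6 = α * α := by rw [show (6 : ℕ) = 2 + 4 from rfl, uSeq_add_four, h3, h2]; ring
  have h7 : uSeq α β 7 = 2 * α * β := by rw [show (7 : ℕ) = 3 + 4 from rfl, uSeq_add_four, h4, h3]; ring
  have h8 : uSeq α β 8 = β * β := by rw [show (8 : ℕ) = 4 + 4 from rfl, uSeq_add_four, h5, h4]; ring
  have h9 : uSeq α β 9 = α * (α * α) := by rw [show (9 : ℕ) = 5 + 4 from rfl, uSeq_add_four, h6, h5]; ring
  set δ := min (min (uSeq α β 6) (uSeq α β 7)) (min (uSeq α β 8) (uSeq α β 9)) with hδ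
  refine ⟨δ, ?_, fun N hN => ?_⟩
  · rw [hδ, h6, h7, h8, h9]; positivity
  · induction N using Nat.strong_induction_on with
    | _ N ih =>
      rcases Nat.lt_or_ge N 10 with hlt | hge
      · interval_cases N
        · exact (min_le_left _ _).trans (min_le_left _ _)
        · exact (min_le_left _ _).trans (min_le_right _ _)
        · exact (min_le_right _ _).trans (min_le_left _ _)
        · exact (min_le_right _ _).trans (min_le_right _ _)
      · obtain ⟨M, rfl⟩ : ∃ M, N = M + 4 := ⟨N - 4, by omega⟩
        rw [uSeq_add_four]
        have hA := mul_le_mul_of_nonneg_left (ih (M + 1) (by omega) (by omega)) hα.le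
        have hB := mul_le_mul_of_nonneg_left (ih M (by omega) (by omega)) hβ.le
        have hsum : α * δ + β * δ = δ := by rw [← add_mul, hαβ, one_mul]
        linarith

/-- A rotation of the honeycomb lattice by `2π/3` about the white origin: `(a,b,c) ↦ (-a-b-[c], a, c)`.
[folklore] -/
private def rotW : hvGraph ≃g hvGraph where
  toEquiv :=
    { toFun := fun v => (-v.1 - v.2.1 - (if v.2.2 then 1 else 0), v.1, v.2.2)
      invFun := fun v => (v.2.1, -v.1 - v.2.1 - (if v.2.2 then 1 else 0), v.2.2)
      left_inv := fun v => by
        obtain ⟨a, b, c⟩ := v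
        refine Prod.ext rfl (Prod.ext ?_ rfl)
        dsimp only
        ring
      right_inv := fun v => by
        obtain ⟨a, b, c⟩ := v
        refine Prod.ext ?_ (Prod.ext rfl rfl)
        dsimp only
        ring }
  map_rel_iff' := by
    rintro ⟨a, b, c⟩ ⟨a', b', c'⟩
    cases c <;> cases c' <;> simp [hvGraph_adj, HV.AdjRel] <;> omega

/-- `rotW` fixes the origin. [folklore] -/
private theorem rotW_origin : rotW hvOrigin = hvOrigin := by
  simp [rotW, hvOrigin]

/-- `rotW` cycles the ports of the origin. [folklore] -/
private theorem rotW_port_origin (k : Fin 3) : rotW (HV.port hvOrigin k) = HV.port hvOrigin (k + 1) := by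
  have h0 : ((0 : Fin 3) + 1 : Fin 3) = 1 := rfl
  have h1 : ((1 : Fin 3) + 1 : Fin 3) = 2 := rfl
  have h2 : ((2 : Fin 3) + 1 : Fin 3) = 0 := rfl
  fin_cases k <;> simp [rotW, hvOrigin, HV.port, h0, h1, h2]

/-- The honeycomb walks of length `n` from the origin whose first step goes to `port O k`.
[folklore] -/
private def firstStepClass (n : ℕ) (k : Fin 3) : Finset (List HV) :=
  (HV.sawFin hvOrigin n).filter fun l => l[1]? = some (HV.port hvOrigin k)

/-- The rotation maps one first-step class into the next. [folklore] -/
private theorem card_firstStepClass_le_succ (n : ℕ) (k : Fin 3) :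
    (firstStepClass n k).card ≤ (firstStepClass n (k + 1)).card := by
  refine Finset.card_le_card_of_injOn (fun l => l.map rotW) ?_ ?_
  · intro l hl
    rw [Finset.mem_coe, firstStepClass, Finset.mem_filter, HV.mem_sawFin_iff] at hl ⊢
    refine ⟨?_, ?_⟩
    · have := (map_mem_sawLists_iff rotW (l := l) (v := hvOrigin) (n := n)).2 hl.1
      rwa [rotW_origin] at this
    · rw [List.getElem?_map, hl.2, Option.map_some, rotW_port_origin]
  · intro l _ l' _ h
    exact (List.map_injective_iff.2 rotW.injective) h

/-- **One third of the walks start towards the black cell `(0,0)`**: for `n ≥ 1`,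
`cₙ(ℍ) ≤ 3 · #firstStepClass n 0`. [folklore] -/
private theorem hexSawCount_le_three_mul (n : ℕ) (hn : 1 ≤ n) :
    hexSawCount n ≤ 3 * (firstStepClass n 0).card := by
  have h01 := card_firstStepClass_le_succ n 0
  have h12 := card_firstStepClass_le_succ n 1
  have h20 := card_firstStepClass_le_succ n 2
  have e1 : ((0 : Fin 3) + 1 : Fin 3) = 1 := rfl
  have e2 : ((1 : Fin 3) + 1 : Fin 3) = 2 := rfl
  have e0 : ((2 : Fin 3) + 1 : Fin 3) = 0 := rfl
  rw [e1] at h01; rw [e2] at h12; rw [e0] at h20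
  have hcover : HV.sawFin hvOrigin n ⊆ firstStepClass n 0 ∪ (firstStepClass n 1 ∪ firstStepClass n 2) := by
    intro l hl
    have hl' := HV.mem_sawFin_iff.1 hl
    obtain ⟨hc, hh, hlen, -⟩ := hl'
    match l, hh, hlen, hc with
    | [a], _, hlen, _ => simp at hlen; omega
    | a :: v :: rest, hh, _, hc =>
      simp only [List.head?_cons, Option.some.injEq] at hh
      subst hh
      obtain ⟨k, hk⟩ := (HV.adj_iff_exists_port' _ _).1 (List.isChain_cons_cons.1 hc).1
      have hmem : (hvOrigin :: v :: rest) ∈ firstStepClass n k := by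
        rw [firstStepClass, Finset.mem_filter]; exact ⟨hl, by simp [hk]⟩
      fin_cases k
      · exact Finset.mem_union_left _ hmem
      · exact Finset.mem_union_right _ (Finset.mem_union_left _ hmem)
      · exact Finset.mem_union_right _ (Finset.mem_union_right _ hmem)
  calc hexSawCount n = (HV.sawFin hvOrigin n).card := hexSawCount_eq_card n
    _ ≤ (firstStepClass n 0 ∪ (firstStepClass n 1 ∪ firstStepClass n 2)).card := Finset.card_le_card hcover
    _ ≤ (firstStepClass n 0).card + ((firstStepClass n 1).card + (firstStepClass n 2).card) :=
        (Finset.card_union_le _ _).trans (add_le_add le_rfl (Finset.card_union_le _ _))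
    _ ≤ 3 * (firstStepClass n 0).card := by omega

/-- The tail of a self-avoiding list is a self-avoiding list from the second vertex. [folklore] -/
private theorem tail_mem_sawLists {V : Type*} {G : SimpleGraph V} {a b : V} {L : List V} {N : ℕ}
    (h : (a :: b :: L) ∈ sawLists G a (N + 1)) : (b :: L) ∈ sawLists G b N := by
  obtain ⟨hc, -, hlen, hn⟩ := h
  exact ⟨(List.isChain_cons_cons.1 hc).2, rfl, by simpa using hlen, (List.nodup_cons.1 hn).2⟩

/-- **Counting form of the lower bound, white root**:
`Σ_{s ∈ comp N} c_{2|s|}(ℍ) ≤ w_N`. [folklore] -/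
private theorem sum_hexSawCount_le_wCount (N : ℕ) :
    ∑ s ∈ comp N, hexSawCount (2 * s.length) ≤ wCount N := by
  classical
  have hO : hvOrigin.2.2 = false := rfl
  have e : ∑ s ∈ comp N, hexSawCount (2 * s.length) =
      ((comp N).sigma fun s => HV.sawFin hvOrigin (2 * s.length)).card := by
    rw [Finset.card_sigma]
    exact Finset.sum_congr rfl fun s _ => hexSawCount_eq_card _
  rw [e, wCount]
  refine Finset.card_le_card_of_injOn (fun d => MV.lift d.1 d.2) ?_ ?_
  · rintro ⟨s, l⟩ hd
    rw [Finset.mem_coe, Finset.mem_sigma] at hd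
    rw [Finset.mem_coe, MV.mem_sawFin_iff]
    have h := MV.lift_mem_sawLists hO (HV.mem_sawFin_iff.1 hd.2) rfl
    rwa [size_of_mem_comp N s hd.1] at h
  · rintro ⟨s, l⟩ hd ⟨s', l'⟩ hd' h
    simp only [Finset.mem_coe, Finset.mem_sigma] at hd hd'
    obtain ⟨h1, h2⟩ := MV.lift_inj hO (HV.mem_sawFin_iff.1 hd.2) (HV.mem_sawFin_iff.1 hd'.2) h
    subst h1; subst h2; rfl

/-- Members of `comp N` are nonempty for `N ≥ 1`. [folklore] -/
private theorem length_pos_of_mem_comp {N : ℕ} (hN : 1 ≤ N) {s : List Bool} (hs : s ∈ comp N) : 1 ≤ s.length := by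
  have := size_of_mem_comp N s hs
  rcases s with _ | ⟨b, s⟩
  · simp at this; omega
  · simp

/-- **Counting form of the lower bound, corner root**: for `N ≥ 1`,
`Σ_{s ∈ comp N} c_{2|s|}(ℍ) ≤ 3 · k_{N-1}` (the walks whose first step enters the cell `(0,0)`,
with the first vertex deleted). [folklore] -/
private theorem sum_hexSawCount_le_kCount (N : ℕ) (hN : 1 ≤ N) :
    ∑ s ∈ comp N, hexSawCount (2 * s.length) ≤ 3 * kCount (N - 1) := by
  classical
  have hO : hvOrigin.2.2 = false := rfl
  have hstep : ∑ s ∈ comp N, hexSawCount (2 * s.length) ≤ ∑ s ∈ comp N, 3 * (firstStepClass (2 * s.length) 0).card :=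
    Finset.sum_le_sum fun s hs => hexSawCount_le_three_mul _ (by have := length_pos_of_mem_comp hN hs; omega)
  refine hstep.trans ?_
  rw [← Finset.mul_sum, ← Finset.card_sigma]
  refine Nat.mul_le_mul_left 3 ?_
  rw [kCount]
  refine Finset.card_le_card_of_injOn (fun d => (MV.lift d.1 d.2).tail) ?_ ?_
  · rintro ⟨s, l⟩ hd
    rw [Finset.mem_coe, Finset.mem_sigma, firstStepClass, Finset.mem_filter] at hd
    obtain ⟨hs, hl, h1⟩ := hd
    rw [Finset.mem_coe, MV.mem_sawFin_iff]
    have h := MV.lift_mem_sawLists hO (HV.mem_sawFin_iff.1 hl) rfl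
    rw [size_of_mem_comp N s hs] at h
    -- the lift is `wv O :: corner (0,0,true) 0 :: …`
    obtain ⟨hc, hh, hlen, hn⟩ := HV.mem_sawFin_iff.1 hl
    match l, hh, h1, h with
    | a :: v :: rest, hh, h1, h =>
      simp only [List.head?_cons, Option.some.injEq] at hh
      subst hh
      simp only [List.getElem?_cons_succ, List.getElem?_cons_zero, Option.some.injEq] at h1
      subst h1
      obtain ⟨M, hM⟩ : ∃ M, N = M + 1 := ⟨N - 1, by omega⟩
      subst hM
      dsimp only
      rw [MV.lift] at h ⊢
      obtain ⟨L, hL⟩ := MV.liftPairs_eq_cons s hvOrigin (HV.port hvOrigin 0) rest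
      rw [hL] at h ⊢
      have hmC : MV.corner (HV.port hvOrigin 0) (HV.pidx (HV.port hvOrigin 0) hvOrigin) = mC := by
        have : HV.pidx (HV.port hvOrigin 0) hvOrigin = 0 := by
          have e := HV.pidx_port' (HV.port hvOrigin 0) 0
          rwa [HV.port_port'] at e
        rw [this]; rfl
      rw [List.tail_cons, show M + 1 - 1 = M from rfl]
      rw [hmC] at h ⊢
      exact tail_mem_sawLists h
  · rintro ⟨s, l⟩ hd ⟨s', l'⟩ hd' h
    simp only [Finset.mem_coe, Finset.mem_sigma, firstStepClass, Finset.mem_filter] at hd hd'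
    have hl := HV.mem_sawFin_iff.1 hd.2.1
    have hl' := HV.mem_sawFin_iff.1 hd'.2.1
    have hfull : MV.lift s l = MV.lift s' l' := by
      obtain ⟨-, hh, hlen, -⟩ := hl
      obtain ⟨-, hh', hlen', -⟩ := hl'
      match l, l', hh, hh', h with
      | a :: r, a' :: r', hh, hh', h =>
        simp only [List.head?_cons, Option.some.injEq] at hh hh'
        subst hh; subst hh'
        simp only [MV.lift, List.tail_cons] at h ⊢
        rw [h]
    obtain ⟨h1, h2⟩ := MV.lift_inj hO hl hl' hfull
    subst h1; subst h2; rfl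

/-! ### The upper bound, I: good walks from a white vertex and the first-unit recursion -/

namespace MV

/-- Every neighbour of a white vertex is the entry corner of one of its three black neighbours.
[folklore] -/
private theorem adj_wv_iff {u : HV} (hu : u.2.2 = false) {q : MV} :
    martiniGraph.Adj (wv u) q ↔ ∃ j : Fin 3, q = corner (HV.port u j) (HV.pidx (HV.port u j) u) := by
  obtain ⟨a, b, c⟩ := u
  simp only at hu
  subst hu
  constructor
  · intro h
    obtain ⟨x, y, s⟩ := q
    cases s with
    | none => exact absurd h (by simp [wv, martiniGraph_adj, AdjRel])
    | some k' =>
      simp only [wv, martiniGraph_adj, AdjRel] at h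
      have hB : (x, y, true) = HV.port (a, b, false) k' := by
        have := HV.port_port' (x, y, true) k'
        rw [h] at this; exact this.symm
      refine ⟨k', ?_⟩
      rw [← hB, ← h, HV.pidx_port']
      rfl
  · rintro ⟨j, rfl⟩
    have hB : (HV.port (a, b, false) j).2.2 = true := by rw [HV.port_colour]; rfl
    exact (adj_corner_wv hB (HV.adj_port' (a, b, false) j).symm).symm

/-- Every neighbour of a corner is a mate or its white vertex. [folklore] -/
private theorem adj_corner_iff {B : HV} (hB : B.2.2 = true) {k : Fin 3} {q : MV} :
    martiniGraph.Adj (corner B k) q ↔ (∃ k', k' ≠ k ∧ q = corner B k') ∨ q = wv (HV.port B k) := by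
  obtain ⟨a, b, c⟩ := B
  simp only at hB
  subst hB
  constructor
  · intro h
    obtain ⟨x, y, s⟩ := q
    cases s with
    | none =>
      right
      simp only [corner, martiniGraph_adj, AdjRel] at h
      rw [wv, h]
    | some k' =>
      left
      simp only [corner, martiniGraph_adj, AdjRel] at h
      obtain ⟨rfl, rfl, hk⟩ := h
      exact ⟨k', fun e => hk e.symm, rfl⟩
  · rintro (⟨k', hk, rfl⟩ | rfl)
    · exact adj_corner_corner (fun e => hk e.symm)
    · have := adj_corner_wv (v := (a, b, true)) rfl (HV.adj_port' (a, b, true) k)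
      rwa [HV.pidx_port'] at this

/-- `hexOf` of a white vertex determines it. [folklore] -/
private theorem eq_wv_of_hexOf {p : MV} {u : HV} (hu : u.2.2 = false) (h : hexOf p = u) : p = wv u := by
  obtain ⟨x, y, s⟩ := p
  cases s with
  | none => simp only [hexOf] at h; subst h; rfl
  | some k => simp only [hexOf] at h; subst h; simp at hu

/-- `hexOf` of a corner is black; the corner is `corner (hexOf p) k`. [folklore] -/
private theorem eq_corner_of_hexOf {p : MV} {B : HV} (hB : B.2.2 = true) (h : hexOf p = B) : ∃ k, p = corner B k := by
  obtain ⟨x, y, s⟩ := p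
  cases s with
  | none => simp only [hexOf] at h; subst h; simp at hB
  | some k => simp only [hexOf] at h; subst h; exact ⟨k, rfl⟩

/-- `hexOf` of `wv`/`corner` in general. [folklore] -/
@[simp] private theorem hexOf_wv' (u : HV) : hexOf (wv u) = (u.1, u.2.1, false) := rfl

/-- See `hexOf_wv'`. [folklore] -/
@[simp] private theorem hexOf_corner' (v : HV) (k : Fin 3) : hexOf (corner v k) = (v.1, v.2.1, true) := rfl

/-- The black cell of the `i`-th vertex of a list (junk beyond the end). [folklore] -/
private def triAt (π : List MV) (i : ℕ) : HV := hexOf (π.getD i mW)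

/-- Goodness: a honeycomb cell, once left, is never visited again. [folklore] -/
private def Good (π : List MV) : Prop :=
  ∀ j < π.length, ∀ i < j, triAt π i = triAt π j → triAt π (i + 1) = triAt π i

/-- `Good` is decidable. [folklore] -/
private instance (π : List MV) : Decidable (Good π) := by unfold Good; infer_instance

/-- The good walks of length `N` from the white vertex `u` whose cells avoid `S`. [folklore] -/
private def goodW (u : HV) (S : Finset HV) (N : ℕ) : Finset (List MV) :=
  (sawFin (wv u) N).filter fun π => Good π ∧ ∀ c ∈ π, hexOf c ∉ S

/-- Membership in `goodW`. [folklore] -/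
private theorem mem_goodW {u : HV} {S : Finset HV} {N : ℕ} {π : List MV} :
    π ∈ goodW u S N ↔ π ∈ sawLists martiniGraph (wv u) N ∧ Good π ∧ ∀ c ∈ π, hexOf c ∉ S := by
  rw [goodW, mem_filter, mem_sawFin_iff]

/-- `triAt` of a cons at a successor index. [folklore] -/
@[simp] private theorem triAt_cons_succ (a : MV) (l : List MV) (i : ℕ) : triAt (a :: l) (i + 1) = triAt l i := by
  simp [triAt, List.getD_eq_getElem?_getD]

/-- `triAt` at `0`. [folklore] -/
@[simp] private theorem triAt_cons_zero (a : MV) (l : List MV) : triAt (a :: l) 0 = hexOf a := by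
  simp [triAt, List.getD_eq_getElem?_getD]

/-- Goodness passes to the tail. [folklore] -/
private theorem Good.tail {a : MV} {l : List MV} (h : Good (a :: l)) : Good l := by
  intro j hj i hij he
  have := h (j + 1) (by simp; omega) (i + 1) (by omega)
  simp only [triAt_cons_succ] at this
  exact this he

/-- A good walk that has left its first cell never returns to it. [folklore] -/
private theorem Good.not_mem_of_left {a b : MV} {l : List MV} (h : Good (a :: b :: l)) (hab : hexOf b ≠ hexOf a) :
    ∀ c ∈ b :: l, hexOf c ≠ hexOf a := by
  intro c hc heq
  obtain ⟨j, hj, hjc⟩ := List.getElem_of_mem hc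
  have := h (j + 1) (by simp only [List.length_cons] at hj ⊢; omega) 0 (by omega) (by
    rw [triAt_cons_zero, triAt_cons_succ, triAt, List.getD_eq_getElem?_getD, List.getElem?_eq_getElem hj,
      Option.getD_some, hjc, heq])
  rw [triAt_cons_succ, triAt_cons_zero, triAt_cons_zero] at this
  exact hab this

/-- A walk in `goodW u S N` starts at `wv u`. [folklore] -/
private theorem exists_eq_cons_of_mem_goodW {u : HV} {S : Finset HV} {N : ℕ} {π : List MV}
    (h : π ∈ goodW u S N) : ∃ L, π = wv u :: L := by
  obtain ⟨⟨-, hh, -, -⟩, -⟩ := mem_goodW.1 h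
  rcases π with _ | ⟨a, L⟩
  · simp at hh
  · simp only [List.head?_cons, Option.some.injEq] at hh
    exact ⟨L, by rw [hh]⟩

/-- At most one good walk of length `0`. [folklore] -/
private theorem card_goodW_zero (u : HV) (S : Finset HV) : (goodW u S 0).card ≤ 1 := by
  refine Finset.card_le_one.2 fun π hπ π' hπ' => ?_
  have h1 := (mem_goodW.1 hπ).1.2.2.1
  have h2 := (mem_goodW.1 hπ').1.2.2.1
  obtain ⟨L, rfl⟩ := exists_eq_cons_of_mem_goodW hπ
  obtain ⟨L', rfl⟩ := exists_eq_cons_of_mem_goodW hπ'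
  simp at h1 h2
  rw [h1, h2]

/-- The trivial good walk. [folklore] -/
private theorem card_goodW_zero_eq {u : HV} {S : Finset HV} (hu : u.2.2 = false) (huS : u ∉ S) :
    (goodW u S 0).card = 1 := by
  refine le_antisymm (card_goodW_zero u S) (Finset.card_pos.2 ⟨[wv u], ?_⟩)
  rw [mem_goodW]
  refine ⟨⟨List.isChain_singleton _, rfl, rfl, List.nodup_singleton _⟩, ?_, ?_⟩
  · intro j hj i hij; simp at hj; omega
  · intro c hc; simp at hc; subst hc; rwa [hexOf_wv hu]

/-- Walks whose start is forbidden do not exist. [folklore] -/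
private theorem card_goodW_eq_zero {u : HV} {S : Finset HV} (hu : u.2.2 = false) (huS : u ∈ S) (N : ℕ) :
    (goodW u S N).card = 0 := by
  rw [Finset.card_eq_zero, Finset.eq_empty_iff_forall_notMem]
  intro π hπ
  have hS := (mem_goodW.1 hπ).2.2
  obtain ⟨L, rfl⟩ := exists_eq_cons_of_mem_goodW hπ
  exact hS (wv u) (by simp) (by rwa [hexOf_wv hu])

/-- A walk of length `N + 1` from a white vertex passes first through an entry corner. [folklore] -/
private theorem exists_entry {u : HV} (hu : u.2.2 = false) {N : ℕ} {π : List MV}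
    (hπ : π ∈ sawLists martiniGraph (wv u) (N + 1)) :
    ∃ (j : Fin 3) (L : List MV), π = wv u :: corner (HV.port u j) (HV.pidx (HV.port u j) u) :: L ∧
      L.length = N := by
  obtain ⟨hc, hh, hlen, -⟩ := hπ
  match π, hh, hlen, hc with
  | a :: q :: L, hh, hlen, hc =>
    simp only [List.head?_cons, Option.some.injEq] at hh
    subst hh
    obtain ⟨j, rfl⟩ := (adj_wv_iff hu).1 (List.isChain_cons_cons.1 hc).1
    exact ⟨j, L, rfl, by simpa using hlen⟩

/-- The three neighbours of a vertex, indexed by `Fin 3`. [folklore] -/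
private def nbr3 : MV → Fin 3 → MV
  | (a, b, none), t => corner (HV.port (a, b, false) t) (HV.pidx (HV.port (a, b, false) t) (a, b, false))
  | (a, b, some k), t => if t = k then wv (HV.port (a, b, true) k) else corner (a, b, true) t

/-- Every neighbour is some `nbr3 p t`. [folklore] -/
private theorem exists_nbr3_eq_of_adj {p q : MV} (h : martiniGraph.Adj p q) : ∃ t, nbr3 p t = q := by
  obtain ⟨a, b, s⟩ := p
  cases s with
  | none =>
    obtain ⟨j, rfl⟩ := (adj_wv_iff (u := (a, b, false)) rfl).1 h
    exact ⟨j, rfl⟩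
  | some k =>
    rcases (adj_corner_iff (B := (a, b, true)) rfl).1 h with ⟨k', hk, rfl⟩ | rfl
    · exact ⟨k', by simp [nbr3, hk]⟩
    · exact ⟨k, by simp [nbr3]⟩

/-- The last vertex of a list (junk on `[]`). [folklore] -/
private def lastV (ρ : List MV) : MV := ρ.getLast?.getD mW

/-- Peeling the last vertex: `#sawFin p (M+1) ≤ 3 · #sawFin p M`. [folklore] -/
private theorem card_sawFin_succ_le (p : MV) (M : ℕ) : #(sawFin p (M + 1)) ≤ 3 * #(sawFin p M) := by
  classical
  have hsub : sawFin p (M + 1) ⊆ (sawFin p M ×ˢ (univ : Finset (Fin 3))).image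
      fun ρt => ρt.1 ++ [nbr3 (lastV ρt.1) ρt.2] := by
    intro π hπ
    obtain ⟨hc, hh, hlen, hn⟩ := mem_sawFin_iff.1 hπ
    have hne : π ≠ [] := by rintro rfl; simp at hlen
    have e1 : π.getLast hne = π[M + 1]'(by omega) := by
      rw [List.getLast_eq_getElem]; congr 1; omega
    have e2 : lastV π.dropLast = π[M]'(by omega) := by
      have hl2 : π.dropLast.length - 1 = M := by rw [List.length_dropLast, hlen]; omega
      rw [lastV, List.getLast?_eq_getElem?, hl2, List.dropLast_eq_take, List.getElem?_take,
        if_pos (by omega), List.getElem?_eq_getElem (by omega), Option.getD_some]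
    have hlast : martiniGraph.Adj (lastV π.dropLast) (π.getLast hne) := by
      rw [e1, e2]; exact hc.getElem M (by omega)
    obtain ⟨t, ht⟩ := exists_nbr3_eq_of_adj hlast
    rw [mem_image]
    refine ⟨(π.dropLast, t), mem_product.2 ⟨mem_sawFin_iff.2 ⟨hc.dropLast, ?_, by
      rw [List.length_dropLast, hlen]; rfl, hn.sublist (List.dropLast_sublist π)⟩, mem_univ _⟩, ?_⟩
    · rw [List.dropLast_eq_take, List.head?_take, if_neg (by omega), hh]
    · simp only
      rw [ht, List.dropLast_append_getLast hne]
  calc #(sawFin p (M + 1)) ≤ _ := card_le_card hsub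
    _ ≤ #(sawFin p M ×ˢ (univ : Finset (Fin 3))) := card_image_le
    _ = 3 * #(sawFin p M) := by rw [card_product]; simp [mul_comm]

/-- `#sawFin p N ≤ 3^N`. [folklore] -/
private theorem card_sawFin_le_pow (p : MV) : ∀ N, #(sawFin p N) ≤ 3 ^ N
  | 0 => by
    refine (Finset.card_le_one.2 fun π hπ π' hπ' => ?_).trans (by norm_num)
    obtain ⟨-, hh, hl, -⟩ := mem_sawFin_iff.1 hπ
    obtain ⟨-, hh', hl', -⟩ := mem_sawFin_iff.1 hπ'
    match π, π', hh, hh', hl, hl' with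
    | [a], [b], hh, hh', _, _ => simp at hh hh'; rw [hh, hh']
  | N + 1 => (card_sawFin_succ_le p N).trans (by rw [pow_succ]; linarith [card_sawFin_le_pow p N])

/-- `#goodW u S N ≤ 3^N`. [folklore] -/
private theorem card_goodW_le_pow (u : HV) (S : Finset HV) (N : ℕ) : (goodW u S N).card ≤ 3 ^ N :=
  (card_le_card (filter_subset _ _)).trans (card_sawFin_le_pow _ N)

end MV

namespace MV

/-- The tail of a good walk after a unit ending with the exit corner `corner B e` and the white
vertex `wv (port B e)` is a good walk avoiding `S ∪ {u, B}`. [folklore] -/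
private theorem tail_mem_goodW {u B : HV} {e : Fin 3} {S : Finset HV} {pre rest : List MV} {M : ℕ}
    (hc : (pre ++ corner B e :: wv (HV.port B e) :: rest).IsChain martiniGraph.Adj)
    (hn : (pre ++ corner B e :: wv (HV.port B e) :: rest).Nodup)
    (hG : Good (corner B e :: wv (HV.port B e) :: rest))
    (hS : ∀ c ∈ wv (HV.port B e) :: rest, hexOf c ∉ S)
    (hU : ∀ c ∈ wv (HV.port B e) :: rest, hexOf c ≠ u) (hB : B.2.2 = true) (hlen : rest.length = M) :
    wv (HV.port B e) :: rest ∈ goodW (HV.port B e) (insert u (insert B S)) M := by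
  rw [mem_goodW]
  have hc2 : (corner B e :: wv (HV.port B e) :: rest).IsChain martiniGraph.Adj := (List.isChain_append.1 hc).2.1
  have hrest : (wv (HV.port B e) :: rest).IsChain martiniGraph.Adj := (List.isChain_cons_cons.1 hc2).2
  have hn2 : (corner B e :: wv (HV.port B e) :: rest).Nodup := hn.sublist (List.sublist_append_right _ _)
  have hleft : hexOf (wv (HV.port B e)) ≠ hexOf (corner B e) := by
    rw [hexOf_wv', hexOf_corner']; simp
  refine ⟨⟨hrest, rfl, by simp [hlen], (List.nodup_cons.1 hn2).2⟩, hG.tail, fun c hcm => ?_⟩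
  rw [Finset.mem_insert, Finset.mem_insert, not_or, not_or]
  refine ⟨hU c hcm, fun h => hG.not_mem_of_left hleft c hcm ?_, hS c hcm⟩
  rw [h, hexOf_corner', show (B.1, B.2.1, true) = B from by obtain ⟨a, b, c⟩ := B; simp at hB; subst hB; rfl]

/-- The admissible (entry cell, exit corner) pairs of a first unit from the white vertex `u`
avoiding `S`: `B = port u j ∉ S`, exit `e ≠` entry, `port B e ∉ S`. [folklore] -/
private def unitPairs (u : HV) (S : Finset HV) : Finset (Fin 3 × Fin 3) :=
  ((univ : Finset (Fin 3)) ×ˢ (univ : Finset (Fin 3))).filter fun je =>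
    HV.port u je.1 ∉ S ∧ je.2 ≠ HV.pidx (HV.port u je.1) u ∧ HV.port (HV.port u je.1) je.2 ∉ S

/-- Membership in `unitPairs`. [folklore] -/
private theorem mem_unitPairs {u : HV} {S : Finset HV} {je : Fin 3 × Fin 3} :
    je ∈ unitPairs u S ↔ HV.port u je.1 ∉ S ∧ je.2 ≠ HV.pidx (HV.port u je.1) u ∧
      HV.port (HV.port u je.1) je.2 ∉ S := by
  simp [unitPairs]

/-- `#unitPairs ≤ 9`. [folklore] -/
private theorem card_unitPairs_le (u : HV) (S : Finset HV) : (unitPairs u S).card ≤ 9 :=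
  (card_le_card (filter_subset _ _)).trans (by rw [card_product]; simp)

/-- **First-unit recursion**: for `N ≥ 3`, a good walk from the white vertex `u` avoiding `S` either
ends inside its first triangle (`N = 3`, the long way) or reaches the white vertex `u' = port B e`
beyond the exit corner `e` of its first triangle `B = port u j` after `3` (short) or `4` (long) steps and
continues as a good walk from `u'` avoiding `S ∪ {u, B}`. [folklore] -/
private theorem card_goodW_le {u : HV} (hu : u.2.2 = false) (S : Finset HV) (N : ℕ) (hN : 3 ≤ N) :
    (goodW u S N).card ≤ (if N = 3 then 9 else 0) +
      ∑ je ∈ unitPairs u S,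
        ((goodW (HV.port (HV.port u je.1) je.2) (insert u (insert (HV.port u je.1) S)) (N - 3)).card +
          (goodW (HV.port (HV.port u je.1) je.2) (insert u (insert (HV.port u je.1) S)) (N - 4)).card) := by
  classical
  set T₁ : Finset (List MV) := if N = 3 then ((univ : Finset (Fin 3)) ×ˢ (univ : Finset (Fin 3))).image
    (fun je => [wv u, corner (HV.port u je.1) (HV.pidx (HV.port u je.1) u), corner (HV.port u je.1) je.2,
      corner (HV.port u je.1) (HV.third' (HV.pidx (HV.port u je.1) u) je.2)]) else ∅ with hT₁
  set T₂ : Finset (List MV) := (unitPairs u S).biUnion fun je =>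
    (goodW (HV.port (HV.port u je.1) je.2) (insert u (insert (HV.port u je.1) S)) (N - 3)).image fun τ =>
      wv u :: corner (HV.port u je.1) (HV.pidx (HV.port u je.1) u) :: corner (HV.port u je.1) je.2 :: τ
    with hT₂
  set T₃ : Finset (List MV) := (unitPairs u S).biUnion fun je =>
    (goodW (HV.port (HV.port u je.1) je.2) (insert u (insert (HV.port u je.1) S)) (N - 4)).image fun τ =>
      wv u :: corner (HV.port u je.1) (HV.pidx (HV.port u je.1) u) ::
        corner (HV.port u je.1) (HV.third' (HV.pidx (HV.port u je.1) u) je.2) :: corner (HV.port u je.1) je.2 :: τ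
    with hT₃
  have hBblack : ∀ j : Fin 3, (HV.port u j).2.2 = true := fun j => by rw [HV.port_colour, hu]; rfl
  have hportk : ∀ j : Fin 3, HV.port (HV.port u j) (HV.pidx (HV.port u j) u) = u := fun j =>
    HV.port_pidx' (HV.adj_port' u j).symm
  have hsub : goodW u S N ⊆ T₁ ∪ (T₂ ∪ T₃) := by
    intro π hπ
    have hπ' := mem_goodW.1 hπ
    obtain ⟨hsaw, hG, hS⟩ := hπ'
    obtain ⟨M, rfl⟩ : ∃ M, N = M + 1 := ⟨N - 1, by omega⟩
    obtain ⟨j, L, rfl, hL⟩ := exists_entry hu hsaw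
    obtain ⟨hc, -, hl, hn⟩ := hsaw
    rcases L with _ | ⟨c₂, _ | ⟨c₃, rest⟩⟩
    · simp at hL; omega
    · simp at hL; omega
    have hB := hBblack j
    have hBS : HV.port u j ∉ S := by
      have := hS (corner (HV.port u j) (HV.pidx (HV.port u j) u)) (by simp)
      rwa [hexOf_corner hB] at this
    -- `c₂` is a mate of the entry corner
    have hc12 : martiniGraph.Adj (corner (HV.port u j) (HV.pidx (HV.port u j) u)) c₂ :=
      (List.isChain_cons_cons.1 (List.isChain_cons_cons.1 hc).2).1
    rcases (adj_corner_iff hB).1 hc12 with ⟨k₁, hk₁, rfl⟩ | rfl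
    swap
    · exfalso; rw [hportk] at hn; simp at hn
    -- `c₃` is the third corner or the white exit
    have hc23 : martiniGraph.Adj (corner (HV.port u j) k₁) c₃ :=
      (List.isChain_cons_cons.1 (List.isChain_cons_cons.1 (List.isChain_cons_cons.1 hc).2).2).1
    have hUtail : ∀ c ∈ corner (HV.port u j) k₁ :: c₃ :: rest, hexOf c ≠ u := by
      intro c hcm h
      have := eq_wv_of_hexOf hu h
      subst this
      exact (List.nodup_cons.1 hn).1 (List.mem_cons_of_mem _ hcm)
    rw [mem_union, mem_union]
    rcases (adj_corner_iff hB).1 hc23 with ⟨k₂, hk₂, rfl⟩ | rfl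
    · -- long way: `k₂` is the third corner
      have hk₂k : k₂ ≠ HV.pidx (HV.port u j) u := by
        rintro h; rw [h] at hn; simp at hn
      have hk2 : k₂ = HV.third' (HV.pidx (HV.port u j) u) k₁ := by
        have h1 := hk₁; have h2 := hk₂; have h3 := hk₂k
        revert h1 h2 h3
        generalize HV.pidx (HV.port u j) u = a; generalize k₁ = b; generalize k₂ = c
        fin_cases a <;> fin_cases b <;> fin_cases c <;> decide
      rcases rest with _ | ⟨c₄, rest⟩
      · left
        have hN3 : M + 1 = 3 := by simp at hl; omega
        simp only [hT₁, hN3, if_true, mem_image]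
        exact ⟨(j, k₁), mem_product.2 ⟨mem_univ _, mem_univ _⟩, by rw [hk2]⟩
      · right; right
        have hc34 : martiniGraph.Adj (corner (HV.port u j) k₂) c₄ :=
          (List.isChain_cons_cons.1 (List.isChain_cons_cons.1 (List.isChain_cons_cons.1
            (List.isChain_cons_cons.1 hc).2).2).2).1
        rcases (adj_corner_iff hB).1 hc34 with ⟨k₃, hk₃, rfl⟩ | rfl
        · exfalso
          have : k₃ = HV.pidx (HV.port u j) u ∨ k₃ = k₁ := by
            have h1 := hk₁; have h2 := hk₂; have h3 := hk₂k; have h4 := hk₃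
            revert h1 h2 h3 h4
            generalize HV.pidx (HV.port u j) u = a; generalize k₁ = b; generalize k₂ = c; generalize k₃ = d
            fin_cases a <;> fin_cases b <;> fin_cases c <;> fin_cases d <;> decide
          rcases this with rfl | rfl <;> simp at hn
        have heS : HV.port (HV.port u j) k₂ ∉ S := by
          have := hS (wv (HV.port (HV.port u j) k₂)) (by simp)
          rwa [hexOf_wv (by rw [HV.port_colour, hB]; rfl)] at this
        have hk1' : k₁ = HV.third' (HV.pidx (HV.port u j) u) k₂ := by
          rw [hk2]; have h1 := hk₁; revert h1
          generalize HV.pidx (HV.port u j) u = a; generalize k₁ = b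
          fin_cases a <;> fin_cases b <;> decide
        simp only [hT₃, mem_biUnion, mem_image]
        refine ⟨(j, k₂), mem_unitPairs.2 ⟨hBS, hk₂k, heS⟩, wv (HV.port (HV.port u j) k₂) :: rest, ?_,
          by rw [← hk1']⟩
        refine tail_mem_goodW (pre := [wv u, corner (HV.port u j) (HV.pidx (HV.port u j) u),
          corner (HV.port u j) k₁]) (by simpa using hc) (by simpa using hn) hG.tail.tail.tail
          (fun c hc' => hS c (by simp [hc'])) (fun c hc' => hUtail c (by simp [hc'])) hB (by simp at hl ⊢; omega)
    · -- short way: exit at `k₁`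
      right; left
      have heS : HV.port (HV.port u j) k₁ ∉ S := by
        have := hS (wv (HV.port (HV.port u j) k₁)) (by simp)
        rwa [hexOf_wv (by rw [HV.port_colour, hB]; rfl)] at this
      simp only [hT₂, mem_biUnion, mem_image]
      refine ⟨(j, k₁), mem_unitPairs.2 ⟨hBS, hk₁, heS⟩, wv (HV.port (HV.port u j) k₁) :: rest, ?_, rfl⟩
      exact tail_mem_goodW (pre := [wv u, corner (HV.port u j) (HV.pidx (HV.port u j) u)]) (by simpa using hc)
        (by simpa using hn) hG.tail.tail (fun c hc' => hS c (by simp [hc']))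
        (fun c hc' => hUtail c (by simp [hc'])) hB (by simp at hl ⊢; omega)
  have h1 : T₁.card ≤ if N = 3 then 9 else 0 := by
    simp only [hT₁]
    split_ifs
    · refine card_image_le.trans ?_
      rw [card_product]; simp
    · simp
  have h2 : T₂.card ≤ ∑ je ∈ unitPairs u S,
      (goodW (HV.port (HV.port u je.1) je.2) (insert u (insert (HV.port u je.1) S)) (N - 3)).card :=
    card_biUnion_le.trans (sum_le_sum fun je _ => card_image_le)
  have h3 : T₃.card ≤ ∑ je ∈ unitPairs u S,
      (goodW (HV.port (HV.port u je.1) je.2) (insert u (insert (HV.port u je.1) S)) (N - 4)).card :=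
    card_biUnion_le.trans (sum_le_sum fun je _ => card_image_le)
  calc (goodW u S N).card ≤ (T₁ ∪ (T₂ ∪ T₃)).card := card_le_card hsub
    _ ≤ T₁.card + (T₂.card + T₃.card) := (card_union_le _ _).trans (add_le_add le_rfl (card_union_le _ _))
    _ ≤ _ := by rw [sum_add_distrib]; exact add_le_add h1 (add_le_add h2 h3)

end MV

/-! ### The upper bound, II: honeycomb walks avoiding a set, two-step prepend, and the
generating-function induction -/

namespace HV

/-- Honeycomb self-avoiding lists of length `n` from `v` avoiding `S`. [folklore] -/
private def hAvoid (v : HV) (S : Finset HV) (n : ℕ) : Finset (List HV) := (sawFin v n).filter fun l => ∀ u ∈ l, u ∉ S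

/-- Membership in `hAvoid`. [folklore] -/
private theorem mem_hAvoid {v : HV} {S : Finset HV} {n : ℕ} {l : List HV} :
    l ∈ hAvoid v S n ↔ l ∈ sawLists hvGraph v n ∧ ∀ u ∈ l, u ∉ S := by
  rw [hAvoid, mem_filter, mem_sawFin_iff]

/-- `#hAvoid v S 0 = 1` for allowed `v`. [folklore] -/
private theorem card_hAvoid_zero {v : HV} {S : Finset HV} (hv : v ∉ S) : (hAvoid v S 0).card = 1 := by
  refine le_antisymm (Finset.card_le_one.2 fun l hl l' hl' => ?_) (Finset.card_pos.2 ⟨[v], ?_⟩)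
  · obtain ⟨⟨-, hh, hlen, -⟩, -⟩ := mem_hAvoid.1 hl
    obtain ⟨⟨-, hh', hlen', -⟩, -⟩ := mem_hAvoid.1 hl'
    match l, l', hh, hh', hlen, hlen' with
    | [a], [b], hh, hh', _, _ => simp at hh hh'; rw [hh, hh']
  · rw [mem_hAvoid]
    exact ⟨⟨List.isChain_singleton _, rfl, rfl, List.nodup_singleton _⟩, by simpa using hv⟩

/-- `hAvoid v ∅ n = sawFin v n`. [folklore] -/
private theorem hAvoid_empty (v : HV) (n : ℕ) : hAvoid v ∅ n = sawFin v n := by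
  rw [hAvoid, Finset.filter_true_of_mem]; simp

/-- **Two-step prepend**: `Σ_{(j,e) admissible} h_n(port (port v j) e, S ∪ {v, port v j}) ≤ h_{n+2}(v, S)`.
[folklore] -/
private theorem sum_card_hAvoid_le {v : HV} {S : Finset HV} (hv : v ∉ S) (n : ℕ) :
    ∑ je ∈ MV.unitPairs v S, (hAvoid (port (port v je.1) je.2) (insert v (insert (port v je.1) S)) n).card ≤
      (hAvoid v S (n + 2)).card := by
  classical
  rw [← card_sigma]
  refine card_le_card_of_injOn (fun d => v :: port v d.1.1 :: d.2) ?_ ?_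
  · rintro ⟨⟨j, e⟩, l⟩ hd
    rw [mem_coe, mem_sigma, MV.mem_unitPairs] at hd
    obtain ⟨⟨hBS, hek, heS⟩, hl⟩ := hd
    obtain ⟨⟨hc, hh, hlen, hn⟩, hS⟩ := mem_hAvoid.1 hl
    rw [mem_coe, mem_hAvoid]
    rcases l with _ | ⟨a, L⟩
    · simp at hh
    simp only [List.head?_cons, Option.some.injEq] at hh
    subst hh
    have hvB : v ≠ port v j := fun h => by
      have := port_colour v j; rw [← h] at this; cases hc' : v.2.2 <;> simp [hc'] at this
    refine ⟨⟨List.IsChain.cons_cons (adj_port' v j) (List.IsChain.cons_cons (adj_port' _ e) hc), rfl,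
      by simp at hlen ⊢; omega, ?_⟩, ?_⟩
    · rw [List.nodup_cons, List.nodup_cons]
      refine ⟨fun h => ?_, fun h => (hS _ h) (by simp), hn⟩
      rcases List.mem_cons.1 h with h | h
      · exact hvB h
      · exact (hS v h) (by simp)
    · intro u hu
      rcases List.mem_cons.1 hu with rfl | hu
      · exact hv
      · rcases List.mem_cons.1 hu with rfl | hu
        · exact hBS
        · exact fun h => hS u hu (by simp [h])
  · rintro ⟨⟨j, e⟩, l⟩ hd ⟨⟨j', e'⟩, l'⟩ hd' h
    simp only [mem_coe, mem_sigma] at hd hd'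
    obtain ⟨-, h1, h2⟩ := List.cons_eq_cons.1 h |>.2 |> fun h' => (⟨trivial, List.cons_eq_cons.1 h'⟩ : True ∧ _)
    have hj : j = j' := port_injective' v h1
    subst hj
    subst h2
    obtain ⟨⟨-, hh, -, -⟩, -⟩ := mem_hAvoid.1 hd.2
    obtain ⟨⟨-, hh', -, -⟩, -⟩ := mem_hAvoid.1 hd'.2
    rw [hh'] at hh
    simp only [Option.some.injEq] at hh
    have he : e = e' := port_injective' _ hh.symm
    subst he
    rfl

end HV

namespace MV

/-- **Generating-function domination**: for `0 ≤ x`, every `M`, every white `u ∉ S`: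
`Σ_{N ≤ M} #goodW(u, S, N) x^N ≤ c₀(x) · Σ_{n ≤ M} #hAvoid(u, S, 2n) (x³(1+x))ⁿ` with
`c₀(x) = 1 + 3x + 9x² + 18x³`. [folklore] -/
private theorem gf_goodW_le {x : ℝ} (hx0 : 0 ≤ x) :
    ∀ (M : ℕ) (u : HV) (S : Finset HV), u.2.2 = false → u ∉ S →
      ∑ N ∈ range (M + 1), ((goodW u S N).card : ℝ) * x ^ N ≤
        (1 + 3 * x + 9 * x ^ 2 + 18 * x ^ 3) *
          ∑ n ∈ range (M + 1), ((HV.hAvoid u S (2 * n)).card : ℝ) * (x ^ 3 * (1 + x)) ^ n := by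
  classical
  obtain ⟨c, hc⟩ : ∃ c : ℝ, c = 1 + 3 * x + 9 * x ^ 2 + 18 * x ^ 3 := ⟨_, rfl⟩
  obtain ⟨y, hy⟩ : ∃ y : ℝ, y = x ^ 3 * (1 + x) := ⟨_, rfl⟩
  rw [← hc, ← hy]
  have hc1 : 1 ≤ c := by
    have : 0 ≤ 3 * x + 9 * x ^ 2 + 18 * x ^ 3 := by positivity
    rw [hc]; linarith
  have hy0 : 0 ≤ y := by rw [hy]; positivity
  intro M
  induction M using Nat.strong_induction_on with
  | _ M ih =>
    intro u S hu huS
    have hH0 : ∀ M', 1 ≤ ∑ n ∈ range (M' + 1), ((HV.hAvoid u S (2 * n)).card : ℝ) * y ^ n := fun M' => by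
      have h0 : ((HV.hAvoid u S (2 * 0)).card : ℝ) * y ^ 0 = 1 := by rw [HV.card_hAvoid_zero huS]; simp
      rw [← h0]
      exact single_le_sum (f := fun n => ((HV.hAvoid u S (2 * n)).card : ℝ) * y ^ n) (fun n _ => by positivity)
        (mem_range.2 (Nat.succ_pos _))
    have hgle : ∀ N, ((goodW u S N).card : ℝ) ≤ 3 ^ N := fun N => by exact_mod_cast card_goodW_le_pow u S N
    have hg0 : ((goodW u S 0).card : ℝ) ≤ 1 := by simpa using hgle 0
    have hg1 : ((goodW u S 1).card : ℝ) ≤ 3 := by simpa using hgle 1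
    have hg2 : ((goodW u S 2).card : ℝ) ≤ 9 := by have := hgle 2; norm_num at this; exact_mod_cast this
    rcases Nat.lt_or_ge M 3 with hM | hM
    · have : ∑ N ∈ range (M + 1), ((goodW u S N).card : ℝ) * x ^ N ≤ 1 + 3 * x + 9 * x ^ 2 := by
        interval_cases M
        · simp; nlinarith
        · rw [sum_range_succ, sum_range_succ, sum_range_zero]; simp; nlinarith
        · rw [sum_range_succ, sum_range_succ, sum_range_succ, sum_range_zero]; simp; nlinarith
      calc _ ≤ 1 + 3 * x + 9 * x ^ 2 := this
        _ ≤ c * 1 := by rw [hc]; nlinarith [pow_nonneg hx0 3]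
        _ ≤ c * _ := mul_le_mul_of_nonneg_left (hH0 M) (by linarith)
    obtain ⟨M', rfl⟩ : ∃ M', M = M' + 3 := ⟨M - 3, by omega⟩
    set P := unitPairs u S with hP
    -- abbreviations for the branch data
    have hPle : (P.card : ℝ) ≤ 9 := by exact_mod_cast card_unitPairs_le u S
    obtain ⟨g', hg'⟩ : ∃ g' : Fin 3 × Fin 3 → ℕ → ℝ, g' = fun je m =>
      ((goodW (HV.port (HV.port u je.1) je.2) (insert u (insert (HV.port u je.1) S)) m).card : ℝ) := ⟨_, rfl⟩
    obtain ⟨G', hG'⟩ : ∃ G' : Fin 3 × Fin 3 → ℕ → ℝ, G' = fun je L => ∑ m ∈ range (L + 1), g' je m * x ^ m :=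
      ⟨_, rfl⟩
    have hg'nn : ∀ je m, 0 ≤ g' je m := fun je m => by simp only [hg']; positivity
    have hg'0 : ∀ je, g' je 0 ≤ 1 := fun je => by simp only [hg']; exact_mod_cast card_goodW_zero _ _
    have hG'nn : ∀ je L, 0 ≤ G' je L := fun je L => by
      simp only [hG']; exact sum_nonneg fun m _ => mul_nonneg (hg'nn je m) (pow_nonneg hx0 m)
    -- the recursion, term by term, for `N = m + 3`
    have hrec : ∀ m, ((goodW u S (m + 3)).card : ℝ) * x ^ (m + 3) ≤
        (if m = 0 then 9 * x ^ 3 else 0) +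
          ∑ je ∈ P, (x ^ 3 * (g' je m * x ^ m) + x ^ (m + 3) * g' je (m + 3 - 4)) := by
      intro m
      have h := card_goodW_le hu S (m + 3) (by omega)
      have h' : ((goodW u S (m + 3)).card : ℝ) ≤ (if m + 3 = 3 then 9 else 0 : ℝ) +
          ∑ je ∈ P, (g' je (m + 3 - 3) + g' je (m + 3 - 4)) := by simp only [hg']; exact_mod_cast h
      rw [show m + 3 - 3 = m by omega] at h'
      have hx3 : 0 ≤ x ^ (m + 3) := pow_nonneg hx0 _
      calc ((goodW u S (m + 3)).card : ℝ) * x ^ (m + 3)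
          ≤ ((if m + 3 = 3 then 9 else 0 : ℝ) + ∑ je ∈ P, (g' je m + g' je (m + 3 - 4))) * x ^ (m + 3) :=
            mul_le_mul_of_nonneg_right h' hx3
        _ = _ := by
            rw [add_mul, sum_mul]
            congr 1
            · split_ifs with h1 h2 h2
              · simp at h1; subst h1; ring
              · simp at h1; exact absurd h1 h2
              · subst h2; simp at h1
              · simp
            · refine sum_congr rfl fun je _ => ?_; ring
    -- sum the recursion over `m ≤ M'`
    have hsum3 : ∑ m ∈ range (M' + 1), ((goodW u S (m + 3)).card : ℝ) * x ^ (m + 3) ≤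
        9 * x ^ 3 + ∑ je ∈ P, (x ^ 3 * G' je M' + (x ^ 3 + x ^ 4 * G' je M')) := by
      refine (sum_le_sum fun m _ => hrec m).trans ?_
      rw [sum_add_distrib, sum_comm]
      refine add_le_add ?_ (sum_le_sum fun je _ => ?_)
      · rw [sum_ite_eq' (range (M' + 1)) 0 (fun _ => 9 * x ^ 3)]; simp
      rw [sum_add_distrib]
      refine add_le_add (by simp only [hG']; rw [← mul_sum]) ?_
      rw [sum_range_succ', show (0 + 3 - 4 : ℕ) = 0 by norm_num]
      have hsp : x ^ (0 + 3) * g' je 0 ≤ x ^ 3 := by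
        rw [show 0 + 3 = 3 by rfl]
        exact mul_le_of_le_one_right (pow_nonneg hx0 3) (hg'0 je)
      have hshift : ∑ m ∈ range M', x ^ (m + 1 + 3) * g' je (m + 1 + 3 - 4) ≤ x ^ 4 * G' je M' := by
        simp only [hG']
        rw [mul_sum]
        calc ∑ m ∈ range M', x ^ (m + 1 + 3) * g' je (m + 1 + 3 - 4)
            = ∑ m ∈ range M', x ^ 4 * (g' je m * x ^ m) :=
              sum_congr rfl fun m _ => by rw [show m + 1 + 3 - 4 = m by omega]; ring
          _ ≤ ∑ m ∈ range (M' + 1), x ^ 4 * (g' je m * x ^ m) :=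
              sum_le_sum_of_subset_of_nonneg (range_subset_range.2 (Nat.le_succ M')) fun m _ _ => by
                have := hg'nn je m; positivity
      linarith
    -- the induction hypothesis on each branch
    have hIH : ∀ je ∈ P, G' je M' ≤ c * ∑ n ∈ range (M' + 1),
        ((HV.hAvoid (HV.port (HV.port u je.1) je.2) (insert u (insert (HV.port u je.1) S)) (2 * n)).card : ℝ) * y ^ n := by
      intro je hje
      rw [hP, mem_unitPairs] at hje
      obtain ⟨hBS, hek, heS⟩ := hje
      have hB : (HV.port u je.1).2.2 = true := by rw [HV.port_colour, hu]; rfl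
      have hu' : (HV.port (HV.port u je.1) je.2).2.2 = false := by rw [HV.port_colour, hB]; rfl
      have hne1 : HV.port (HV.port u je.1) je.2 ≠ u := by
        intro h
        apply hek
        have := HV.port_pidx' (HV.adj_port' u je.1).symm
        exact HV.port_injective' _ (h.trans this.symm)
      have hne2 : HV.port (HV.port u je.1) je.2 ≠ HV.port u je.1 := by
        intro h; have := congrArg (fun w : HV => w.2.2) h; simp only [hu', hB] at this; exact Bool.noConfusion this
      have hnot : HV.port (HV.port u je.1) je.2 ∉ insert u (insert (HV.port u je.1) S) := by
        rw [Finset.mem_insert, Finset.mem_insert, not_or, not_or]; exact ⟨hne1, hne2, heS⟩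
      simp only [hG', hg']
      exact ih M' (by omega) _ _ hu' hnot
    -- the honeycomb two-step prepend bound
    have hhex : y * ∑ je ∈ P, ∑ n ∈ range (M' + 1),
        ((HV.hAvoid (HV.port (HV.port u je.1) je.2) (insert u (insert (HV.port u je.1) S)) (2 * n)).card : ℝ) * y ^ n ≤
        ∑ n ∈ range (M' + 3 + 1), ((HV.hAvoid u S (2 * n)).card : ℝ) * y ^ n - 1 := by
      have hKle : ∑ je ∈ P, ∑ n ∈ range (M' + 1),
          ((HV.hAvoid (HV.port (HV.port u je.1) je.2) (insert u (insert (HV.port u je.1) S)) (2 * n)).card : ℝ) * y ^ n ≤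
          ∑ n ∈ range (M' + 1), ((HV.hAvoid u S (2 * n + 2)).card : ℝ) * y ^ n := by
        rw [sum_comm]
        refine sum_le_sum fun n _ => ?_
        rw [← sum_mul]
        refine mul_le_mul_of_nonneg_right ?_ (pow_nonneg hy0 n)
        rw [← Nat.cast_sum]
        exact Nat.cast_le.2 (HV.sum_card_hAvoid_le huS (2 * n))
      have h0 : ((HV.hAvoid u S (2 * 0)).card : ℝ) * y ^ 0 = 1 := by rw [HV.card_hAvoid_zero huS]; simp
      calc y * ∑ je ∈ P, ∑ n ∈ range (M' + 1),
            ((HV.hAvoid (HV.port (HV.port u je.1) je.2) (insert u (insert (HV.port u je.1) S)) (2 * n)).card : ℝ) * y ^ n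
          ≤ y * ∑ n ∈ range (M' + 1), ((HV.hAvoid u S (2 * n + 2)).card : ℝ) * y ^ n :=
            mul_le_mul_of_nonneg_left hKle hy0
        _ = ∑ n ∈ range (M' + 1), ((HV.hAvoid u S (2 * (n + 1))).card : ℝ) * y ^ (n + 1) := by
            rw [mul_sum]; exact sum_congr rfl fun n _ => by rw [show 2 * (n + 1) = 2 * n + 2 by ring]; ring
        _ ≤ ∑ n ∈ range (M' + 3), ((HV.hAvoid u S (2 * (n + 1))).card : ℝ) * y ^ (n + 1) :=
            sum_le_sum_of_subset_of_nonneg (range_subset_range.2 (by omega))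
              fun n _ _ => mul_nonneg (Nat.cast_nonneg _) (pow_nonneg hy0 _)
        _ = ∑ n ∈ range (M' + 3 + 1), ((HV.hAvoid u S (2 * n)).card : ℝ) * y ^ n - 1 := by
            rw [sum_range_succ' (fun n => ((HV.hAvoid u S (2 * n)).card : ℝ) * y ^ n) (M' + 3), h0]; ring
    -- assemble
    have hmain := calc
      ∑ m ∈ range (M' + 1), ((goodW u S (m + 1 + 1 + 1)).card : ℝ) * x ^ (m + 1 + 1 + 1)
          = ∑ m ∈ range (M' + 1), ((goodW u S (m + 3)).card : ℝ) * x ^ (m + 3) := rfl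
      _ ≤ 9 * x ^ 3 + ∑ je ∈ P, (x ^ 3 * G' je M' + (x ^ 3 + x ^ 4 * G' je M')) := hsum3
      _ = 9 * x ^ 3 + ((∑ _je ∈ P, x ^ 3) + y * ∑ je ∈ P, G' je M') := by
          rw [hy, mul_sum, ← sum_add_distrib]; exact congrArg _ (sum_congr rfl fun je _ => by ring)
      _ ≤ 9 * x ^ 3 + (9 * x ^ 3 + y * ∑ je ∈ P, c * ∑ n ∈ range (M' + 1),
            ((HV.hAvoid (HV.port (HV.port u je.1) je.2) (insert u (insert (HV.port u je.1) S)) (2 * n)).card : ℝ) *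
              y ^ n) := by
          have hKc : (∑ _je ∈ P, x ^ 3) ≤ 9 * x ^ 3 := by
            rw [sum_const, nsmul_eq_mul]
            exact mul_le_mul_of_nonneg_right hPle (pow_nonneg hx0 3)
          exact add_le_add le_rfl (add_le_add hKc (mul_le_mul_of_nonneg_left (sum_le_sum hIH) hy0))
      _ = 18 * x ^ 3 + c * (y * ∑ je ∈ P, ∑ n ∈ range (M' + 1),
            ((HV.hAvoid (HV.port (HV.port u je.1) je.2) (insert u (insert (HV.port u je.1) S)) (2 * n)).card : ℝ) *
              y ^ n) := by rw [← mul_sum]; ring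
      _ ≤ 18 * x ^ 3 + c * (∑ n ∈ range (M' + 3 + 1), ((HV.hAvoid u S (2 * n)).card : ℝ) * y ^ n - 1) :=
          add_le_add le_rfl (mul_le_mul_of_nonneg_left hhex (by linarith))
    conv_lhs => rw [show M' + 3 + 1 = M' + 1 + 1 + 1 + 1 from rfl, sum_range_succ', sum_range_succ', sum_range_succ']
    simp only [pow_zero, mul_one, zero_add, pow_one]
    have h1x : ((goodW u S 1).card : ℝ) * x ≤ 3 * x := mul_le_mul_of_nonneg_right hg1 hx0
    have h2x : ((goodW u S (1 + 1)).card : ℝ) * x ^ (1 + 1) ≤ 9 * x ^ 2 :=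
      mul_le_mul_of_nonneg_right hg2 (pow_nonneg hx0 2)
    have hx2 : 0 ≤ x ^ 2 := pow_nonneg hx0 2
    have hx3 : 0 ≤ x ^ 3 := pow_nonneg hx0 3
    nlinarith [hmain, hg0, h1x, h2x, hc, hH0 (M' + 3)]

end MV

/-! ### The upper bound, III: defects are terminal; all walks vs good walks; corner starts -/

namespace MV

/-- `triAt` as a `getElem`. [folklore] -/
private theorem triAt_eq_getElem {π : List MV} {i : ℕ} (hi : i < π.length) : triAt π i = hexOf (π[i]) := by
  rw [triAt, List.getD_eq_getElem?_getD, List.getElem?_eq_getElem hi, Option.getD_some]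

/-- `triAt` of a prefix. [folklore] -/
private theorem triAt_take {π : List MV} {m i : ℕ} (hi : i < m) : triAt (π.take m) i = triAt π i := by
  simp only [triAt, List.getD_eq_getElem?_getD, List.getElem?_take, if_pos hi]

/-- Prefixes of self-avoiding lists. [folklore] -/
private theorem take_mem_sawLists {p : MV} {M m : ℕ} {π : List MV} (hπ : π ∈ sawLists martiniGraph p M)
    (hm : m ≤ M) : π.take (m + 1) ∈ sawLists martiniGraph p m := by
  obtain ⟨hc, hh, hlen, hnd⟩ := hπ
  refine ⟨hc.take _, ?_, ?_, List.Nodup.sublist (List.take_sublist _ _) hnd⟩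
  · rw [List.head?_take, if_neg (Nat.succ_ne_zero m), hh]
  · rw [List.length_take, hlen]; omega

/-- A neighbour of a corner in another cell is its white vertex. [folklore] -/
private theorem eq_white_of_adj {B : HV} (hB : B.2.2 = true) {k : Fin 3} {q : MV}
    (h : martiniGraph.Adj (corner B k) q) (hne : hexOf q ≠ B) : q = wv (HV.port B k) := by
  rcases (adj_corner_iff hB).1 h with ⟨k', -, rfl⟩ | rfl
  · exact absurd (hexOf_corner hB k') hne
  · rfl

/-- Pigeonhole in a triangle. [folklore] -/
private theorem fin3_cases (a b c d : Fin 3) (hab : a ≠ b) (hbc : b ≠ c) (hac : a ≠ c) : d = a ∨ d = b ∨ d = c := by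
  revert hab hbc hac; fin_cases a <;> fin_cases b <;> fin_cases c <;> fin_cases d <;> decide

/-- **No extension past a re-entry**: a walk from a white vertex whose last vertex re-enters a cell
it left earlier (with no earlier re-entry) has all the neighbours of its endpoint on the walk.
[folklore] -/
private theorem stuck {u : HV} {n : ℕ} {ρ : List MV} (hρ : ρ ∈ sawLists martiniGraph (wv u) n)
    {i : ℕ} (hin : i < n) (hT : triAt ρ i = triAt ρ n) (hleft : triAt ρ (i + 1) ≠ triAt ρ i)
    (hmin : ∀ j < n, ∀ i' < j, triAt ρ i' = triAt ρ j → triAt ρ (i' + 1) = triAt ρ i')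
    {q : MV} (hq : martiniGraph.Adj (ρ.getD n mW) q) : q ∈ ρ := by
  obtain ⟨hc, hh, hlen, hnd⟩ := hρ
  have hl : ∀ m, m ≤ n → m < ρ.length := fun m hm => by rw [hlen]; omega
  have htri : ∀ m (hm : m ≤ n), triAt ρ m = hexOf (ρ[m]'(hl m hm)) := fun m hm => triAt_eq_getElem _
  have hadj : ∀ m m' (hmm : m' = m + 1) (hm' : m' ≤ n),
      martiniGraph.Adj (ρ[m]'(hl m (by omega))) (ρ[m']'(hl m' hm')) := by
    intro m m' hmm hm'; subst hmm; exact hc.getElem m (by rw [hlen]; omega)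
  have hinj : ∀ m m' (hm : m ≤ n) (hm' : m' ≤ n), ρ[m]'(hl m hm) = ρ[m']'(hl m' hm') → m = m' :=
    fun m m' hm hm' h => hnd.getElem_inj_iff.1 h
  -- the common cell `T` is black and `c i`, `c n` are corners of it
  set T := hexOf (ρ[n]'(hl n le_rfl)) with hTdef
  have hTi : hexOf (ρ[i]'(hl i hin.le)) = T := by rw [← htri i hin.le, hT, htri n le_rfl]
  have hTb : T.2.2 = true := by
    by_contra hw
    rw [Bool.not_eq_true] at hw
    have h1 := eq_wv_of_hexOf hw hTi
    have h2 := eq_wv_of_hexOf hw hTdef.symm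
    have := hinj i n hin.le le_rfl (h1.trans h2.symm)
    omega
  obtain ⟨a, ha⟩ := eq_corner_of_hexOf hTb hTi
  obtain ⟨b, hb⟩ := eq_corner_of_hexOf hTb hTdef.symm
  -- the vertex after `i` is the white vertex of `c i`
  have hF1 : ρ[i + 1]'(hl (i + 1) hin) = wv (HV.port T a) := by
    refine eq_white_of_adj hTb (by rw [← ha]; exact hadj i (i + 1) rfl hin) ?_
    rw [← htri (i + 1) hin, ← hTi, ← htri i hin.le]; exact hleft
  -- `i ≥ 1`: the start is white
  have hi1 : 1 ≤ i := by
    rcases Nat.eq_zero_or_pos i with rfl | h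
    · exfalso
      have h0 : ρ[0]'(hl 0 (Nat.zero_le _)) = wv u := by
        rcases ρ with _ | ⟨x, L⟩
        · simp at hlen
        · simp only [List.head?_cons, Option.some.injEq] at hh; simpa using hh
      rw [h0] at ha; simp [wv, corner] at ha
    · exact h
  -- the vertex before `i` lies in the same cell
  have hF2 : hexOf (ρ[i - 1]'(hl (i - 1) (by omega))) = T := by
    by_contra hne
    have h1 : ρ[i - 1]'(hl (i - 1) (by omega)) = wv (HV.port T a) := by
      refine eq_white_of_adj hTb ?_ hne
      rw [← ha]; exact (hadj (i - 1) i (by omega) hin.le).symm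
    have := hinj _ _ (by omega) hin (h1.trans hF1.symm)
    omega
  obtain ⟨a', ha'⟩ := eq_corner_of_hexOf hTb hF2
  -- `n ≥ i + 2`; the vertex before `n` is outside the cell, hence the white vertex of `c n`
  have hn2 : i + 2 ≤ n := by
    by_contra h
    have hn : n = i + 1 := by omega
    subst hn
    exact hleft hT.symm
  have hF3 : hexOf (ρ[n - 1]'(hl (n - 1) (by omega))) ≠ T := by
    intro heq
    apply hleft
    refine hmin (n - 1) (by omega) i (by omega) ?_
    rw [htri i hin.le, htri (n - 1) (by omega), heq, hTi]
  have hF3' : ρ[n - 1]'(hl (n - 1) (by omega)) = wv (HV.port T b) := by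
    refine eq_white_of_adj hTb ?_ hF3
    rw [← hb]; exact (hadj (n - 1) n (by omega) le_rfl).symm
  -- the three corners `c (i-1), c i, c n` are distinct, so they exhaust the triangle
  have hab : a ≠ b := fun h => by
    have := hinj i n hin.le le_rfl (by rw [ha, hb, h]); omega
  have haa' : a' ≠ a := fun h => by
    have := hinj (i - 1) i (by omega) hin.le (by rw [ha', ha, h]); omega
  have ha'b : a' ≠ b := fun h => by
    have := hinj (i - 1) n (by omega) le_rfl (by rw [ha', hb, h]); omega
  have hqn : ρ.getD n mW = ρ[n]'(hl n le_rfl) := by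
    rw [List.getD_eq_getElem?_getD, List.getElem?_eq_getElem (hl n le_rfl), Option.getD_some]
  rw [hqn, hb] at hq
  rcases (adj_corner_iff hTb).1 hq with ⟨d, hd, rfl⟩ | rfl
  · rcases fin3_cases a' a b d haa' hab ha'b with rfl | rfl | rfl
    · rw [← ha']; exact List.getElem_mem _
    · rw [← ha]; exact List.getElem_mem _
    · exact absurd rfl hd
  · rw [← hF3']; exact List.getElem_mem _

/-- A bad pair ending at index `j`. [folklore] -/
private def BadAt (π : List MV) (j : ℕ) : Prop :=
  j < π.length ∧ ∃ i < j, triAt π i = triAt π j ∧ triAt π (i + 1) ≠ triAt π i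

/-- `BadAt` is decidable. [folklore] -/
private instance (π : List MV) (j : ℕ) : Decidable (BadAt π j) := by unfold BadAt; infer_instance

/-- A walk that is not good has a bad pair. [folklore] -/
private theorem exists_badAt_of_not_good {π : List MV} (h : ¬ Good π) : ∃ j, BadAt π j := by
  by_contra hne
  apply h
  intro j hj i hij he
  by_contra hc
  exact hne ⟨j, hj, i, hij, he, hc⟩

/-- **Defects are terminal**: a non-good walk of length `M` from a white vertex has `M ≥ 1` and a
good prefix of length `M - 1`. [folklore] -/
private theorem good_take_of_not_good {u : HV} {M : ℕ} {π : List MV}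
    (hπ : π ∈ sawLists martiniGraph (wv u) M) (hG : ¬ Good π) : 1 ≤ M ∧ Good (π.take M) := by
  classical
  have hex := exists_badAt_of_not_good hG
  obtain ⟨hj₀len, i, hij, hT, hleft⟩ := Nat.find_spec hex
  have hmin : ∀ j < Nat.find hex, ¬ BadAt π j := fun j hj => Nat.find_min hex hj
  set j₀ := Nat.find hex with hj₀
  have hlen := hπ.2.2.1
  have hnd := hπ.2.2.2
  have hjM : j₀ = M := by
    by_contra hne
    have hj₀M : j₀ < M := by omega
    have hρ : π.take (j₀ + 1) ∈ sawLists martiniGraph (wv u) j₀ := take_mem_sawLists hπ hj₀M.le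
    have hq : martiniGraph.Adj ((π.take (j₀ + 1)).getD j₀ mW) (π[j₀ + 1]'(by rw [hlen]; omega)) := by
      rw [List.getD_eq_getElem?_getD, List.getElem?_take, if_pos (Nat.lt_succ_self _),
        List.getElem?_eq_getElem (by rw [hlen]; omega), Option.getD_some]
      exact hπ.1.getElem j₀ (by rw [hlen]; omega)
    have hmem := stuck hρ hij
      (by rw [triAt_take (by omega), triAt_take (by omega)]; exact hT)
      (by rw [triAt_take (by omega), triAt_take (by omega)]; exact hleft)
      (fun j hj i' hi' h => by
        rw [triAt_take (by omega), triAt_take (by omega)] at h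
        rw [triAt_take (by omega), triAt_take (by omega)]
        by_contra hc
        exact hmin j hj ⟨by rw [hlen]; omega, i', hi', h, hc⟩) hq
    obtain ⟨m, hm, hmeq⟩ := List.mem_iff_getElem.1 hmem
    rw [List.getElem_take] at hmeq
    have h1 := hnd.getElem_inj_iff.1 hmeq
    rw [List.length_take] at hm
    omega
  refine ⟨by omega, fun j hj i' hi' h => ?_⟩
  rw [List.length_take, hlen] at hj
  rw [triAt_take (by omega), triAt_take (by omega)] at h
  rw [triAt_take (by omega), triAt_take (by omega)]
  by_contra hc
  exact hmin j (by omega) ⟨by rw [hlen]; omega, i', hi', h, hc⟩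

/-- The last vertex of a proper prefix. [folklore] -/
private theorem lastV_take {π : List MV} {M : ℕ} (h : M < π.length) (hM : 1 ≤ M) : lastV (π.take M) = π[M - 1] := by
  rw [lastV, List.getLast?_eq_getElem?, List.length_take, min_eq_left h.le, List.getElem?_take,
    if_pos (by omega), List.getElem?_eq_getElem (by omega), Option.getD_some]

/-- **All walks vs good walks from a white vertex**: `w_M ≤ g_M + 3 g_{M-1}`. [folklore] -/
private theorem card_sawFin_wv_le (u : HV) (M : ℕ) :
    #(sawFin (wv u) M) ≤ (goodW u ∅ M).card + 3 * (goodW u ∅ (M - 1)).card := by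
  classical
  have hsub : sawFin (wv u) M ⊆ goodW u ∅ M ∪ ((goodW u ∅ (M - 1)) ×ˢ (univ : Finset (Fin 3))).image
      (fun ρt => ρt.1 ++ [nbr3 (lastV ρt.1) ρt.2]) := by
    intro π hπ
    rw [mem_sawFin_iff] at hπ
    rw [mem_union]
    by_cases hG : Good π
    · exact Or.inl (mem_goodW.2 ⟨hπ, hG, fun c _ h => Finset.notMem_empty _ h⟩)
    right
    obtain ⟨hM, hgood⟩ := good_take_of_not_good hπ hG
    have hlen := hπ.2.2.1
    obtain ⟨M', rfl⟩ : ∃ M', M = M' + 1 := ⟨M - 1, by omega⟩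
    rw [show M' + 1 - 1 = M' from rfl]
    have hadj : martiniGraph.Adj (π[M']'(by rw [hlen]; omega)) (π[M' + 1]'(by rw [hlen]; omega)) :=
      hπ.1.getElem M' (by rw [hlen]; omega)
    obtain ⟨t, ht⟩ := exists_nbr3_eq_of_adj hadj
    rw [mem_image]
    refine ⟨(π.take (M' + 1), t), mem_product.2 ⟨mem_goodW.2 ⟨take_mem_sawLists hπ (Nat.le_succ _),
      hgood, fun c _ h => Finset.notMem_empty _ h⟩, mem_univ _⟩, ?_⟩
    have hlast : lastV (π.take (M' + 1)) = π[M']'(by rw [hlen]; omega) := by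
      have := lastV_take (π := π) (M := M' + 1) (by rw [hlen]; omega) (by omega)
      simpa using this
    simp only
    rw [hlast, ht, ← List.take_succ_eq_append_getElem, List.take_of_length_le (by rw [hlen])]
  calc #(sawFin (wv u) M) ≤ _ := card_le_card hsub
    _ ≤ (goodW u ∅ M).card + (((goodW u ∅ (M - 1)) ×ˢ (univ : Finset (Fin 3))).image
          (fun ρt => ρt.1 ++ [nbr3 (lastV ρt.1) ρt.2])).card := card_union_le _ _
    _ ≤ (goodW u ∅ M).card + ((goodW u ∅ (M - 1)) ×ˢ (univ : Finset (Fin 3))).card :=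
        add_le_add le_rfl card_image_le
    _ = _ := by rw [card_product, Finset.card_univ, Fintype.card_fin]; ring

/-- All white vertices have the walk counts of the white root. [folklore] -/
private theorem card_sawFin_wv (u : HV) (M : ℕ) : #(sawFin (wv u) M) = wCount M := by
  rw [wCount, ← ncard_sawLists_eq_card_sawFin, ← ncard_sawLists_eq_card_sawFin]
  have h : mshift (-u.1) (-u.2.1) (wv u) = mW := by simp [wv, mW]
  rw [← h, ncard_sawLists_iso]

/-- **Corner starts vs white starts**: a walk from a corner reaches a white vertex after `1`, `2` or
`3` steps (unless it ends inside its triangle, `N ≤ 2`):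
`#sawFin (corner B k) N ≤ 2·[N ≤ 2] + w_{N-1} + 2 w_{N-2} + 2 w_{N-3}`. [folklore] -/
private theorem card_sawFin_corner_le {B : HV} (hB : B.2.2 = true) (k : Fin 3) (N : ℕ) :
    #(sawFin (corner B k) N) ≤ (if N ≤ 2 then 2 else 0) + wCount (N - 1) + 2 * wCount (N - 2) +
      2 * wCount (N - 3) := by
  classical
  have hw : ∀ k', (HV.port B k').2.2 = false := fun k' => by rw [HV.port_colour, hB]; rfl
  set K := (univ : Finset (Fin 3)).erase k with hK
  set T₀ : Finset (List MV) := if N ≤ 2 then K.image (fun k' => if N = 0 then [corner B k] else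
    if N = 1 then [corner B k, corner B k'] else [corner B k, corner B k', corner B (HV.third' k k')]) else ∅ with hT₀
  set T₁ : Finset (List MV) := (sawFin (wv (HV.port B k)) (N - 1)).image (fun τ => corner B k :: τ) with hT₁
  set T₂ : Finset (List MV) := K.biUnion fun k' => (sawFin (wv (HV.port B k')) (N - 2)).image
    (fun τ => corner B k :: corner B k' :: τ) with hT₂
  set T₃ : Finset (List MV) := K.biUnion fun k' => (sawFin (wv (HV.port B (HV.third' k k'))) (N - 3)).image
    (fun τ => corner B k :: corner B k' :: corner B (HV.third' k k') :: τ) with hT₃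
  have hsub : sawFin (corner B k) N ⊆ T₀ ∪ (T₁ ∪ (T₂ ∪ T₃)) := by
    intro π hπ
    obtain ⟨hc, hh, hlen, hn⟩ := mem_sawFin_iff.1 hπ
    rw [mem_union, mem_union, mem_union]
    rcases π with _ | ⟨c₀, L⟩
    · simp at hlen
    simp only [List.head?_cons, Option.some.injEq] at hh
    subst hh
    rcases L with _ | ⟨c₁, L⟩
    · -- N = 0
      left
      have hN : N = 0 := by simp at hlen; omega
      subst hN
      obtain ⟨k', hk'⟩ : ∃ k' : Fin 3, k' ≠ k := by
        refine ⟨k + 1, fun h => ?_⟩; fin_cases k <;> simp at h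
      rw [hT₀, if_pos (by omega), mem_image]
      exact ⟨k', mem_erase.2 ⟨hk', mem_univ _⟩, by simp⟩
    have h01 : martiniGraph.Adj (corner B k) c₁ := (List.isChain_cons_cons.1 hc).1
    rcases (adj_corner_iff hB).1 h01 with ⟨k₁, hk₁, rfl⟩ | rfl
    · -- first step to a mate
      rcases L with _ | ⟨c₂, L⟩
      · left
        have hN : N = 1 := by simp at hlen; omega
        subst hN
        rw [hT₀, if_pos (by omega), mem_image]
        exact ⟨k₁, mem_erase.2 ⟨hk₁, mem_univ _⟩, by simp⟩
      have h12 : martiniGraph.Adj (corner B k₁) c₂ := (List.isChain_cons_cons.1 (List.isChain_cons_cons.1 hc).2).1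
      rcases (adj_corner_iff hB).1 h12 with ⟨k₂, hk₂, rfl⟩ | rfl
      · -- second step to the third corner
        have hk₂k : k₂ ≠ k := by rintro rfl; simp at hn
        have hk2 : k₂ = HV.third' k k₁ := by
          have h1 := hk₁; have h2 := hk₂; have h3 := hk₂k; revert h1 h2 h3
          fin_cases k <;> fin_cases k₁ <;> fin_cases k₂ <;> decide
        rcases L with _ | ⟨c₃, L⟩
        · left
          have hN : N = 2 := by simp at hlen; omega
          subst hN
          rw [hT₀, if_pos (by omega), mem_image]
          exact ⟨k₁, mem_erase.2 ⟨hk₁, mem_univ _⟩, by simp [hk2]⟩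
        right; right; right
        have h23 : martiniGraph.Adj (corner B k₂) c₃ :=
          (List.isChain_cons_cons.1 (List.isChain_cons_cons.1 (List.isChain_cons_cons.1 hc).2).2).1
        rcases (adj_corner_iff hB).1 h23 with ⟨k₃, hk₃, rfl⟩ | rfl
        · exfalso
          rcases fin3_cases k k₁ k₂ k₃ hk₁.symm hk₂.symm hk₂k.symm with rfl | rfl | rfl
          · simp at hn
          · simp at hn
          · exact hk₃ rfl
        simp only [hT₃, mem_biUnion, mem_image]
        refine ⟨k₁, mem_erase.2 ⟨hk₁, mem_univ _⟩, wv (HV.port B k₂) :: L, ?_, by rw [← hk2]⟩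
        rw [mem_sawFin_iff, ← hk2]
        refine ⟨(List.isChain_cons_cons.1 (List.isChain_cons_cons.1 (List.isChain_cons_cons.1 hc).2).2).2, rfl,
          by simp at hlen ⊢; omega, ?_⟩
        exact (List.nodup_cons.1 (List.nodup_cons.1 (List.nodup_cons.1 hn).2).2).2
      · -- second step to the white vertex of `k₁`
        right; right; left
        simp only [hT₂, mem_biUnion, mem_image]
        refine ⟨k₁, mem_erase.2 ⟨hk₁, mem_univ _⟩, wv (HV.port B k₁) :: L, ?_, rfl⟩
        rw [mem_sawFin_iff]
        refine ⟨(List.isChain_cons_cons.1 (List.isChain_cons_cons.1 hc).2).2, rfl, by simp at hlen ⊢; omega, ?_⟩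
        exact (List.nodup_cons.1 (List.nodup_cons.1 hn).2).2
    · -- first step to the white vertex
      right; left
      simp only [hT₁, mem_image]
      refine ⟨wv (HV.port B k) :: L, ?_, rfl⟩
      rw [mem_sawFin_iff]
      exact ⟨(List.isChain_cons_cons.1 hc).2, rfl, by simp at hlen ⊢; omega, (List.nodup_cons.1 hn).2⟩
  have hKc : K.card = 2 := by rw [hK, card_erase_of_mem (mem_univ _), Finset.card_univ, Fintype.card_fin]
  have h0 : T₀.card ≤ if N ≤ 2 then 2 else 0 := by
    rw [hT₀]
    by_cases hN2 : N ≤ 2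
    · rw [if_pos hN2, if_pos hN2]; exact card_image_le.trans hKc.le
    · rw [if_neg hN2, if_neg hN2, Finset.card_empty]
  have h1 : T₁.card ≤ wCount (N - 1) := card_image_le.trans (by rw [card_sawFin_wv])
  have h2 : T₂.card ≤ 2 * wCount (N - 2) := by
    refine card_biUnion_le.trans ?_
    calc ∑ k' ∈ K, ((sawFin (wv (HV.port B k')) (N - 2)).image (fun τ => corner B k :: corner B k' :: τ)).card
        ≤ ∑ k' ∈ K, wCount (N - 2) := sum_le_sum fun k' _ => card_image_le.trans (by rw [card_sawFin_wv])
      _ = 2 * wCount (N - 2) := by rw [sum_const, hKc, smul_eq_mul]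
  have h3 : T₃.card ≤ 2 * wCount (N - 3) := by
    refine card_biUnion_le.trans ?_
    calc ∑ k' ∈ K, ((sawFin (wv (HV.port B (HV.third' k k'))) (N - 3)).image
          (fun τ => corner B k :: corner B k' :: corner B (HV.third' k k') :: τ)).card
        ≤ ∑ k' ∈ K, wCount (N - 3) := sum_le_sum fun k' _ => card_image_le.trans (by rw [card_sawFin_wv])
      _ = 2 * wCount (N - 3) := by rw [sum_const, hKc, smul_eq_mul]
  calc #(sawFin (corner B k) N) ≤ (T₀ ∪ (T₁ ∪ (T₂ ∪ T₃))).card := card_le_card hsub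
    _ ≤ T₀.card + (T₁.card + (T₂.card + T₃.card)) :=
        (card_union_le _ _).trans (add_le_add le_rfl ((card_union_le _ _).trans
          (add_le_add le_rfl (card_union_le _ _))))
    _ ≤ _ := by linarith

end MV

/-! ### Assembly: generating-function bounds for every start, the root `x₀` of `x³ + x⁴ = μ(ℍ)⁻²`,
and `c_N(v)^{1/N} → 1/x₀` for every vertex `v` of `ℍ̃` -/

section Analysis

/-- Shifting an index costs a factor `1 + x`. [folklore] -/
private theorem sum_shift_le' {f : ℕ → ℝ} (hf : ∀ n, 0 ≤ f n) {x : ℝ} (hx0 : 0 ≤ x) (L : ℕ) :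
    ∑ N ∈ range (L + 1), f (N - 1) * x ^ N ≤ (1 + x) * ∑ N ∈ range (L + 1), f N * x ^ N := by
  rw [sum_range_succ' (fun N => f (N - 1) * x ^ N)]
  simp only [Nat.add_sub_cancel, pow_zero, mul_one, Nat.zero_sub]
  have hS : 0 ≤ ∑ N ∈ range (L + 1), f N * x ^ N := sum_nonneg fun N _ => mul_nonneg (hf N) (pow_nonneg hx0 N)
  have h1 : ∑ N ∈ range L, f N * x ^ (N + 1) ≤ x * ∑ N ∈ range (L + 1), f N * x ^ N := by
    rw [mul_sum]
    calc ∑ N ∈ range L, f N * x ^ (N + 1) = ∑ N ∈ range L, x * (f N * x ^ N) :=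
          sum_congr rfl fun N _ => by ring
      _ ≤ ∑ N ∈ range (L + 1), x * (f N * x ^ N) :=
          sum_le_sum_of_subset_of_nonneg (range_subset_range.2 (Nat.le_succ L)) fun N _ _ =>
            mul_nonneg hx0 (mul_nonneg (hf N) (pow_nonneg hx0 N))
  have h2 : f 0 ≤ ∑ N ∈ range (L + 1), f N * x ^ N := by
    have : f 0 = f 0 * x ^ 0 := by simp
    rw [this]
    exact single_le_sum (f := fun N => f N * x ^ N) (fun N _ => mul_nonneg (hf N) (pow_nonneg hx0 N))
      (mem_range.2 (Nat.succ_pos L))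
  linarith

/-- The even part of the honeycomb generating function is bounded when `y μ(ℍ)² < 1`. [folklore] -/
private theorem exists_hexGF2_bound {y : ℝ} (hy0 : 0 < y) (hlt : y * hexConnectiveConstant ^ 2 < 1) :
    ∃ K : ℝ, ∀ M', ∑ n ∈ range M', (hexSawCount (2 * n) : ℝ) * y ^ n ≤ K := by
  have hμ0 : 0 < hexConnectiveConstant := hexConnectiveConstant_pos
  set ρ := (y * hexConnectiveConstant ^ 2 + 1) / 2 with hρ
  have hρ1 : ρ < 1 := by rw [hρ]; linarith
  have hρ0 : 0 < ρ := by rw [hρ]; positivity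
  set t := Real.sqrt (ρ / y) with ht
  have ht2 : t ^ 2 = ρ / y := by rw [ht, Real.sq_sqrt (by positivity)]
  have hμt : hexConnectiveConstant < t := by
    rw [ht, Real.lt_sqrt hμ0.le, lt_div_iff₀ hy0, hρ]; linarith
  obtain ⟨N₀, hN₀⟩ := eventually_atTop.1 ((tendsto_order.1 tendsto_hexSawCount_rpow).2 _ hμt)
  have htail : ∀ n, N₀ ≤ n → 1 ≤ n → (hexSawCount (2 * n) : ℝ) * y ^ n ≤ ρ ^ n := by
    intro n hn hn1
    have h := hN₀ (2 * n) (by omega)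
    have hc : (0 : ℝ) ≤ hexSawCount (2 * n) := Nat.cast_nonneg _
    have h1 : (hexSawCount (2 * n) : ℝ) = ((hexSawCount (2 * n) : ℝ) ^ (1 / ((2 * n : ℕ) : ℝ))) ^ (2 * n) := by
      rw [one_div, Real.rpow_inv_natCast_pow hc (by omega)]
    have h2 : ((hexSawCount (2 * n) : ℝ) ^ (1 / ((2 * n : ℕ) : ℝ))) ^ (2 * n) ≤ t ^ (2 * n) :=
      pow_le_pow_left₀ (Real.rpow_nonneg hc _) h.le _
    have h3 : t ^ (2 * n) * y ^ n = ρ ^ n := by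
      rw [pow_mul, ht2, ← mul_pow, div_mul_cancel₀ _ hy0.ne']
    calc (hexSawCount (2 * n) : ℝ) * y ^ n ≤ t ^ (2 * n) * y ^ n := by
          rw [h1]; exact mul_le_mul_of_nonneg_right h2 (pow_nonneg hy0.le n)
      _ = ρ ^ n := h3
  refine ⟨∑ n ∈ range (N₀ + 1), (hexSawCount (2 * n) : ℝ) * y ^ n + 1 / (1 - ρ), fun M' => ?_⟩
  have hsplit : ∑ n ∈ range M', (hexSawCount (2 * n) : ℝ) * y ^ n ≤
      ∑ n ∈ range (N₀ + 1), (hexSawCount (2 * n) : ℝ) * y ^ n + ∑ n ∈ range M', ρ ^ n := by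
    rw [← sum_filter_add_sum_filter_not (range M') (fun n => n ≤ N₀)]
    refine add_le_add ?_ ?_
    · refine sum_le_sum_of_subset_of_nonneg ?_ fun n _ _ => by positivity
      intro n hn
      rw [mem_filter, mem_range] at hn
      rw [mem_range]; omega
    · calc ∑ n ∈ (range M').filter (fun n => ¬ n ≤ N₀), (hexSawCount (2 * n) : ℝ) * y ^ n
          ≤ ∑ n ∈ (range M').filter (fun n => ¬ n ≤ N₀), ρ ^ n :=
            sum_le_sum fun n hn => by
              rw [mem_filter] at hn
              exact htail n (by omega) (by omega)
        _ ≤ ∑ n ∈ range M', ρ ^ n :=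
            sum_le_sum_of_subset_of_nonneg (filter_subset _ _) fun n _ _ => pow_nonneg hρ0.le n
  have hgeom : ∑ n ∈ range M', ρ ^ n ≤ 1 / (1 - ρ) := by
    rw [geom_sum_eq hρ1.ne]
    have h1ρ : 0 < 1 - ρ := by linarith
    rw [show (ρ ^ M' - 1) / (ρ - 1) = (1 - ρ ^ M') / (1 - ρ) by
      rw [show ρ ^ M' - 1 = -(1 - ρ ^ M') by ring, show ρ - 1 = -(1 - ρ) by ring, neg_div_neg_eq],
      div_le_div_iff_of_pos_right h1ρ]
    linarith [pow_nonneg hρ0.le M']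
  linarith

/-- **White starts**: `Σ_{N ≤ L} w_N x^N` is bounded when `x³(1+x) μ(ℍ)² < 1`. [folklore] -/
private theorem exists_wGF_bound {x : ℝ} (hx0 : 0 < x) (hlt : x ^ 3 * (1 + x) * hexConnectiveConstant ^ 2 < 1) :
    ∃ C : ℝ, ∀ L, ∑ N ∈ range (L + 1), (wCount N : ℝ) * x ^ N ≤ C := by
  classical
  have hy0 : 0 < x ^ 3 * (1 + x) := by positivity
  obtain ⟨K, hK⟩ := exists_hexGF2_bound hy0 hlt
  have hO : hvOrigin.2.2 = false := rfl
  have hOe : hvOrigin ∉ (∅ : Finset HV) := Finset.notMem_empty _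
  refine ⟨(4 + 3 * x) * ((1 + 3 * x + 9 * x ^ 2 + 18 * x ^ 3) * K), fun L => ?_⟩
  set G := ∑ N ∈ range (L + 1), ((MV.goodW hvOrigin ∅ N).card : ℝ) * x ^ N with hG
  have hG0 : 0 ≤ G := sum_nonneg fun N _ => by positivity
  have hwv : MV.wv hvOrigin = mW := rfl
  have h1 : ∑ N ∈ range (L + 1), (wCount N : ℝ) * x ^ N ≤ G + 3 * ((1 + x) * G) := by
    calc ∑ N ∈ range (L + 1), (wCount N : ℝ) * x ^ N
        ≤ ∑ N ∈ range (L + 1), (((MV.goodW hvOrigin ∅ N).card : ℝ) * x ^ N +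
            3 * (((MV.goodW hvOrigin ∅ (N - 1)).card : ℝ) * x ^ N)) := sum_le_sum fun N _ => by
          have h := MV.card_sawFin_wv_le hvOrigin N
          rw [hwv] at h
          have h' : ((wCount N : ℕ) : ℝ) ≤ ((MV.goodW hvOrigin ∅ N).card : ℝ) +
              3 * ((MV.goodW hvOrigin ∅ (N - 1)).card : ℝ) := by rw [wCount]; exact_mod_cast h
          nlinarith [pow_nonneg hx0.le N]
      _ = G + 3 * ∑ N ∈ range (L + 1), ((MV.goodW hvOrigin ∅ (N - 1)).card : ℝ) * x ^ N := by
          rw [sum_add_distrib, ← mul_sum]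
      _ ≤ G + 3 * ((1 + x) * G) := add_le_add le_rfl (mul_le_mul_of_nonneg_left
          (sum_shift_le' (f := fun N => ((MV.goodW hvOrigin ∅ N).card : ℝ)) (fun _ => Nat.cast_nonneg _) hx0.le L)
          (by norm_num))
  have h2 : G ≤ (1 + 3 * x + 9 * x ^ 2 + 18 * x ^ 3) *
      ∑ n ∈ range (L + 1), (hexSawCount (2 * n) : ℝ) * (x ^ 3 * (1 + x)) ^ n := by
    have h := MV.gf_goodW_le hx0.le L hvOrigin ∅ hO hOe
    have heq : ∀ n, ((HV.hAvoid hvOrigin ∅ (2 * n)).card : ℝ) = hexSawCount (2 * n) := fun n => by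
      rw [HV.hAvoid_empty, ← hexSawCount_eq_card]
    simp only [heq] at h
    exact h
  have hKL := hK (L + 1)
  have hc0 : 0 ≤ 1 + 3 * x + 9 * x ^ 2 + 18 * x ^ 3 := by positivity
  have hH0 : 0 ≤ ∑ n ∈ range (L + 1), (hexSawCount (2 * n) : ℝ) * (x ^ 3 * (1 + x)) ^ n :=
    sum_nonneg fun n _ => by positivity
  calc ∑ N ∈ range (L + 1), (wCount N : ℝ) * x ^ N ≤ G + 3 * ((1 + x) * G) := h1
    _ = (4 + 3 * x) * G := by ring
    _ ≤ (4 + 3 * x) * ((1 + 3 * x + 9 * x ^ 2 + 18 * x ^ 3) * K) :=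
        mul_le_mul_of_nonneg_left (h2.trans (mul_le_mul_of_nonneg_left hKL hc0)) (by positivity)

/-- **Corner starts**: `Σ_{N ≤ L} k_N x^N` is bounded when `x³(1+x) μ(ℍ)² < 1`. [folklore] -/
private theorem exists_kGF_bound {x : ℝ} (hx0 : 0 < x) (hlt : x ^ 3 * (1 + x) * hexConnectiveConstant ^ 2 < 1) :
    ∃ C : ℝ, ∀ L, ∑ N ∈ range (L + 1), (kCount N : ℝ) * x ^ N ≤ C := by
  classical
  obtain ⟨C, hC⟩ := exists_wGF_bound hx0 hlt
  have hC0 : 0 ≤ C := le_trans (by positivity) (hC 0)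
  refine ⟨2 * (1 + x + x ^ 2) + ((1 + x) + 2 * (1 + x) ^ 2 + 2 * (1 + x) ^ 3) * C, fun L => ?_⟩
  set W := ∑ N ∈ range (L + 1), (wCount N : ℝ) * x ^ N with hW
  have hW0 : 0 ≤ W := sum_nonneg fun N _ => by positivity
  have hB : ((0 : ℤ), (0 : ℤ), true).2.2 = true := rfl
  have hmC : MV.corner ((0 : ℤ), (0 : ℤ), true) 0 = mC := rfl
  have hwnn : ∀ n : ℕ, 0 ≤ (wCount n : ℝ) := fun n => Nat.cast_nonneg _
  -- shifted sums
  have hs1 : ∑ N ∈ range (L + 1), (wCount (N - 1) : ℝ) * x ^ N ≤ (1 + x) * W :=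
    sum_shift_le' (f := fun N => (wCount N : ℝ)) hwnn hx0.le L
  have hs2 : ∑ N ∈ range (L + 1), (wCount (N - 2) : ℝ) * x ^ N ≤ (1 + x) ^ 2 * W := by
    have h := sum_shift_le' (f := fun N => (wCount (N - 1) : ℝ)) (fun N => hwnn _) hx0.le L
    have e : ∀ N, (wCount (N - 1 - 1) : ℝ) = wCount (N - 2) := fun N => by rw [show N - 1 - 1 = N - 2 by omega]
    simp only [e] at h
    nlinarith
  have hs3 : ∑ N ∈ range (L + 1), (wCount (N - 3) : ℝ) * x ^ N ≤ (1 + x) ^ 3 * W := by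
    have h := sum_shift_le' (f := fun N => (wCount (N - 2) : ℝ)) (fun N => hwnn _) hx0.le L
    have e : ∀ N, (wCount (N - 1 - 2) : ℝ) = wCount (N - 3) := fun N => by rw [show N - 1 - 2 = N - 3 by omega]
    simp only [e] at h
    have hx1 : 0 ≤ 1 + x := by linarith
    nlinarith [mul_le_mul_of_nonneg_left hs2 hx1]
  have hconst : ∑ N ∈ range (L + 1), (if N ≤ 2 then (2 : ℝ) else 0) * x ^ N ≤ 2 * (1 + x + x ^ 2) := by
    calc ∑ N ∈ range (L + 1), (if N ≤ 2 then (2 : ℝ) else 0) * x ^ N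
        ≤ ∑ N ∈ range 3, (if N ≤ 2 then (2 : ℝ) else 0) * x ^ N := by
          rw [← sum_filter_add_sum_filter_not (range (L + 1)) (fun N => N ≤ 2)]
          have hz : ∑ N ∈ (range (L + 1)).filter (fun N => ¬ N ≤ 2), (if N ≤ 2 then (2 : ℝ) else 0) * x ^ N = 0 :=
            sum_eq_zero fun N hN => by rw [mem_filter] at hN; simp [hN.2]
          rw [hz, add_zero]
          refine sum_le_sum_of_subset_of_nonneg (fun N hN => ?_) fun N _ _ => by positivity
          rw [mem_filter, mem_range] at hN; rw [mem_range]; omega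
      _ = 2 * (1 + x + x ^ 2) := by
          simp only [sum_range_succ, sum_range_zero]; norm_num; ring
  calc ∑ N ∈ range (L + 1), (kCount N : ℝ) * x ^ N
      ≤ ∑ N ∈ range (L + 1), ((if N ≤ 2 then (2 : ℝ) else 0) * x ^ N + ((wCount (N - 1) : ℝ) * x ^ N +
          2 * ((wCount (N - 2) : ℝ) * x ^ N) + 2 * ((wCount (N - 3) : ℝ) * x ^ N))) := sum_le_sum fun N _ => by
        have h := MV.card_sawFin_corner_le hB 0 N
        rw [hmC] at h
        have h' : ((kCount N : ℕ) : ℝ) ≤ (if N ≤ 2 then (2 : ℝ) else 0) + wCount (N - 1) + 2 * wCount (N - 2) +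
            2 * wCount (N - 3) := by
          rw [kCount]; split_ifs with hN2 <;> simp only [hN2, if_true, if_false] at h <;> exact_mod_cast h
        nlinarith [pow_nonneg hx0.le N]
    _ = ∑ N ∈ range (L + 1), (if N ≤ 2 then (2 : ℝ) else 0) * x ^ N +
          (∑ N ∈ range (L + 1), (wCount (N - 1) : ℝ) * x ^ N + 2 * ∑ N ∈ range (L + 1), (wCount (N - 2) : ℝ) * x ^ N +
            2 * ∑ N ∈ range (L + 1), (wCount (N - 3) : ℝ) * x ^ N) := by
        rw [sum_add_distrib, sum_add_distrib, sum_add_distrib, ← mul_sum, ← mul_sum]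
    _ ≤ 2 * (1 + x + x ^ 2) + ((1 + x) * W + 2 * ((1 + x) ^ 2 * W) + 2 * ((1 + x) ^ 3 * W)) := by
        gcongr
    _ ≤ _ := by nlinarith [hC L, pow_nonneg (show (0:ℝ) ≤ 1 + x by linarith) 2,
                  pow_nonneg (show (0:ℝ) ≤ 1 + x by linarith) 3]

/-- **Every start**: `c_N(p) x^N ≤ C` for all `N`, when `0 < x` and `x³(1+x) μ(ℍ)² < 1`. [folklore] -/
private theorem exists_term_bound {x : ℝ} (hx0 : 0 < x) (hlt : x ^ 3 * (1 + x) * hexConnectiveConstant ^ 2 < 1) :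
    ∃ C : ℝ, ∀ (p : MV) (N : ℕ), (sawCount martiniGraph p N : ℝ) * x ^ N ≤ C := by
  obtain ⟨C₁, hC₁⟩ := exists_wGF_bound hx0 hlt
  obtain ⟨C₂, hC₂⟩ := exists_kGF_bound hx0 hlt
  refine ⟨max C₁ C₂, fun p N => ?_⟩
  have hw : (wCount N : ℝ) * x ^ N ≤ C₁ :=
    (single_le_sum (f := fun N => (wCount N : ℝ) * x ^ N) (fun N _ => by positivity)
      (mem_range.2 (Nat.lt_succ_self N))).trans (hC₁ N)
  have hk : (kCount N : ℝ) * x ^ N ≤ C₂ :=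
    (single_le_sum (f := fun N => (kCount N : ℝ) * x ^ N) (fun N _ => by positivity)
      (mem_range.2 (Nat.lt_succ_self N))).trans (hC₂ N)
  rcases MV.sawCount_eq_root p N with h | h
  · rw [h, MV.sawCount_eq_card_sawFin, show #(MV.sawFin mW N) = wCount N from rfl]
    exact hw.trans (le_max_left _ _)
  · rw [h, MV.sawCount_eq_card_sawFin, show #(MV.sawFin mC N) = kCount N from rfl]
    exact hk.trans (le_max_right _ _)

/-- `μ(ℍ) ≥ 1` (from `μ(ℍ) = √(2+√2)`). [folklore] -/
private theorem one_le_hexConnectiveConstant' : 1 ≤ hexConnectiveConstant := by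
  rw [hexConnectiveConstant_eq_of_thm1 DuminilCopinSmirnov2012_thm1_holds, Real.le_sqrt (by norm_num) (by positivity)]
  have := Real.sqrt_nonneg 2; linarith

/-- **The root**: there is `x₀ ∈ (0, 1]` with `x₀³ + x₀⁴ = μ(ℍ)⁻²`. [folklore] -/
private theorem exists_root : ∃ x₀ : ℝ, 0 < x₀ ∧ x₀ ≤ 1 ∧ x₀ ^ 3 + x₀ ^ 4 = (hexConnectiveConstant ^ 2)⁻¹ := by
  have hμ1 := one_le_hexConnectiveConstant'
  have hc : ContinuousOn (fun x : ℝ => x ^ 3 + x ^ 4) (Set.Icc 0 1) := by fun_prop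
  have h0 : (0 : ℝ) ^ 3 + 0 ^ 4 ≤ (hexConnectiveConstant ^ 2)⁻¹ := by norm_num; positivity
  have h1 : (hexConnectiveConstant ^ 2)⁻¹ ≤ (1 : ℝ) ^ 3 + 1 ^ 4 := by
    have : 1 ≤ hexConnectiveConstant ^ 2 := by nlinarith
    have := inv_le_one_of_one_le₀ this
    linarith
  obtain ⟨x₀, hx₀, hx⟩ := intermediate_value_Icc (zero_le_one' ℝ) hc ⟨h0, h1⟩
  refine ⟨x₀, ?_, hx₀.2, hx⟩
  rcases hx₀.1.eq_or_lt with h | h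
  · exfalso
    rw [← h] at hx
    norm_num at hx
    exact absurd hx (by positivity)
  · exact h

/-- **Lower bound for every start**: with `x₀` as above there are `κ > 0` and `N₀` such that
`c_N(p) ≥ κ x₀^{-N}` for every vertex `p` and `N ≥ N₀`. [folklore] -/
private theorem exists_lower {x₀ : ℝ} (hx0 : 0 < x₀) (hx1 : x₀ ≤ 1)
    (hroot : x₀ ^ 3 + x₀ ^ 4 = (hexConnectiveConstant ^ 2)⁻¹) :
    ∃ κ : ℝ, 0 < κ ∧ ∀ (p : MV) (N : ℕ), 6 ≤ N → κ * x₀⁻¹ ^ N ≤ (sawCount martiniGraph p N : ℝ) := by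
  have hμ0 : 0 < hexConnectiveConstant := hexConnectiveConstant_pos
  set α := hexConnectiveConstant ^ 2 * x₀ ^ 3 with hα
  set β := hexConnectiveConstant ^ 2 * x₀ ^ 4 with hβ
  have hα0 : 0 < α := by positivity
  have hβ0 : 0 < β := by positivity
  have hαβ : α + β = 1 := by
    rw [hα, hβ, ← mul_add, hroot, mul_inv_cancel₀ (by positivity)]
  obtain ⟨δ, hδ, hu⟩ := uSeq_ge hα0 hβ0 hαβ
  -- the composition sum is `x₀^{-N} u_N`
  have hterm : ∀ N, ∀ s ∈ comp N, (hexConnectiveConstant ^ (2 * s.length) : ℝ) * x₀ ^ N =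
      α ^ s.count false * β ^ s.count true := by
    intro N s hs
    have h1 := size_of_mem_comp N s hs
    have h2 := count_false_add_count_true s
    rw [hα, hβ, mul_pow, mul_pow, ← pow_mul, ← pow_mul, ← pow_mul, ← pow_mul]
    have eN : N = 3 * s.count false + 4 * s.count true := by omega
    have eL : 2 * s.length = 2 * s.count false + 2 * s.count true := by omega
    rw [eN, eL, pow_add, pow_add]; ring
  have hsum : ∀ N, (∑ s ∈ comp N, (hexSawCount (2 * s.length) : ℝ)) * x₀ ^ N ≥ uSeq α β N := by
    intro N
    rw [uSeq, sum_mul]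
    refine sum_le_sum fun s hs => ?_
    rw [← hterm N s hs]
    exact mul_le_mul_of_nonneg_right (by exact_mod_cast hexConnectiveConstant_pow_le (2 * s.length))
      (pow_nonneg hx0.le N)
  refine ⟨δ / 3, by positivity, fun p N hN => ?_⟩
  have hxN : 0 < x₀ ^ N := pow_pos hx0 N
  rcases MV.sawCount_eq_root p N with h | h
  · -- white root
    rw [h, MV.sawCount_eq_card_sawFin, show #(MV.sawFin mW N) = wCount N from rfl]
    have h1 : (∑ s ∈ comp N, (hexSawCount (2 * s.length) : ℝ)) ≤ wCount N := by
      exact_mod_cast sum_hexSawCount_le_wCount N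
    have h2 := hsum N
    have h3 := hu N hN
    rw [inv_pow, ← div_eq_mul_inv, div_le_iff₀ hxN]
    nlinarith
  · -- corner root
    rw [h, MV.sawCount_eq_card_sawFin, show #(MV.sawFin mC N) = kCount N from rfl]
    have h1 : (∑ s ∈ comp (N + 1), (hexSawCount (2 * s.length) : ℝ)) ≤ 3 * kCount N := by
      have := sum_hexSawCount_le_kCount (N + 1) (by omega)
      rw [Nat.add_sub_cancel] at this
      exact_mod_cast this
    have h2 := hsum (N + 1)
    have h3 := hu (N + 1) (by omega)
    rw [inv_pow, ← div_eq_mul_inv, div_le_iff₀ hxN]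
    rw [pow_succ] at h2
    have e1 : (∑ s ∈ comp (N + 1), (hexSawCount (2 * s.length) : ℝ)) * (x₀ ^ N * x₀) ≤
        3 * (kCount N : ℝ) * (x₀ ^ N * x₀) := mul_le_mul_of_nonneg_right h1 (by positivity)
    have e2 : (kCount N : ℝ) * x₀ ^ N * x₀ ≤ (kCount N : ℝ) * x₀ ^ N := mul_le_of_le_one_right (by positivity) hx1
    linarith

/-- `κ^{1/N} → 1`. [folklore] -/
private theorem tendsto_const_rpow_inv {κ : ℝ} (hκ : 0 < κ) :
    Tendsto (fun N : ℕ => κ ^ (1 / (N : ℝ))) atTop (𝓝 1) := by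
  have h : Tendsto (fun N : ℕ => Real.exp (Real.log κ / N)) atTop (𝓝 (Real.exp 0)) :=
    (Real.continuous_exp.tendsto 0).comp (tendsto_const_div_atTop_nhds_zero_nat (Real.log κ))
  rw [Real.exp_zero] at h
  refine h.congr fun N => ?_
  rw [Real.rpow_def_of_pos hκ]; congr 1; ring

/-- **The connective constant of `ℍ̃` from every start**: `c_N(p)^{1/N} → 1/x₀`. [folklore] -/
private theorem tendsto_sawCount_rpow {x₀ : ℝ} (hx0 : 0 < x₀) (hx1 : x₀ ≤ 1)
    (hroot : x₀ ^ 3 + x₀ ^ 4 = (hexConnectiveConstant ^ 2)⁻¹) (p : MV) :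
    Tendsto (fun N : ℕ => (sawCount martiniGraph p N : ℝ) ^ (1 / (N : ℝ))) atTop (𝓝 x₀⁻¹) := by
  have hμ0 : 0 < hexConnectiveConstant := hexConnectiveConstant_pos
  obtain ⟨κ, hκ, hlow⟩ := exists_lower hx0 hx1 hroot
  rw [tendsto_order]
  constructor
  · -- lower: eventually `b < c_N^{1/N}`
    intro b hb
    have hev := (tendsto_order.1 ((tendsto_const_rpow_inv hκ).mul_const x₀⁻¹)).1 b (by simpa using hb)
    filter_upwards [hev, eventually_ge_atTop 6] with N hN hN6
    have hN0 : (N : ℝ) ≠ 0 := by exact_mod_cast (show N ≠ 0 by omega)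
    have h1 := hlow p N hN6
    have hc : (0 : ℝ) ≤ sawCount martiniGraph p N := Nat.cast_nonneg _
    have h2 : (κ * x₀⁻¹ ^ N) ^ (1 / (N : ℝ)) ≤ (sawCount martiniGraph p N : ℝ) ^ (1 / (N : ℝ)) :=
      Real.rpow_le_rpow (by positivity) h1 (by positivity)
    have h3 : (κ * x₀⁻¹ ^ N) ^ (1 / (N : ℝ)) = κ ^ (1 / (N : ℝ)) * x₀⁻¹ := by
      rw [Real.mul_rpow hκ.le (by positivity), one_div, Real.pow_rpow_inv_natCast (by positivity) (by omega)]
    rw [h3] at h2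
    exact lt_of_lt_of_le hN h2
  · -- upper: eventually `c_N^{1/N} < b`
    intro b hb
    have hb0 : 0 < b := lt_trans (inv_pos.2 hx0) hb
    set x := (b⁻¹ + x₀) / 2 with hx
    have hbx : b⁻¹ < x₀ := by rw [inv_lt_comm₀ hb0 hx0]; exact hb
    have hxpos : 0 < x := by rw [hx]; positivity
    have hxlt : x < x₀ := by rw [hx]; linarith
    have hxb : x⁻¹ < b := by
      rw [inv_lt_comm₀ hxpos hb0, hx]; linarith
    have hlt : x ^ 3 * (1 + x) * hexConnectiveConstant ^ 2 < 1 := by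
      have hmono : x ^ 3 * (1 + x) < x₀ ^ 3 * (1 + x₀) := by
        have := pow_lt_pow_left₀ hxlt hxpos.le (by norm_num : (3:ℕ) ≠ 0)
        nlinarith [pow_pos hxpos 3, pow_pos hx0 3]
      have e : x₀ ^ 3 * (1 + x₀) * hexConnectiveConstant ^ 2 = 1 := by
        rw [show x₀ ^ 3 * (1 + x₀) = x₀ ^ 3 + x₀ ^ 4 by ring, hroot, inv_mul_cancel₀ (by positivity)]
      nlinarith [pow_pos hμ0 2]
    obtain ⟨C, hC⟩ := exists_term_bound hxpos hlt
    have hC0 : 0 < C + 1 := by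
      have := hC p 0; simp at this; linarith
    have hev := (tendsto_order.1 ((tendsto_const_rpow_inv hC0).mul_const x⁻¹)).2 b (by simpa using hxb)
    filter_upwards [hev, eventually_ge_atTop 1] with N hN hN1
    have hc : (0 : ℝ) ≤ sawCount martiniGraph p N := Nat.cast_nonneg _
    have h1 : (sawCount martiniGraph p N : ℝ) ≤ (C + 1) * x⁻¹ ^ N := by
      have := hC p N
      rw [inv_pow, ← div_eq_mul_inv, le_div_iff₀ (pow_pos hxpos N)]; linarith
    have h2 : (sawCount martiniGraph p N : ℝ) ^ (1 / (N : ℝ)) ≤ ((C + 1) * x⁻¹ ^ N) ^ (1 / (N : ℝ)) :=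
      Real.rpow_le_rpow hc h1 (by positivity)
    have h3 : ((C + 1) * x⁻¹ ^ N) ^ (1 / (N : ℝ)) = (C + 1) ^ (1 / (N : ℝ)) * x⁻¹ := by
      rw [Real.mul_rpow hC0.le (by positivity), one_div, Real.pow_rpow_inv_natCast (by positivity) (by omega)]
    rw [h3] at h2
    exact lt_of_le_of_lt h2 hN

/-- **Grimmett–Li 2013, Theorem 3(a) at `G = ℍ`, in the printed vocabulary**: the martini lattice
`ℍ̃` has a connective constant `μ̃` in the sense (2.1) (the limit exists from EVERY start — proved,
not assumed) and "`μ⁻² = h(μ̃⁻¹)`, `h(x) = x³ + x⁴`" with `μ = μ(ℍ) = √(2+√2)`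
(Duminil-Copin–Smirnov; Ding–Fu–Guo–Deng 2012 eq. (9): `1/μ̃³ + 1/μ̃⁴ = 1 - √2/2`). [cite: GrimmettLi2013Fisher, Theorem 3(a)] [cite: DingFuGuo2012, eq. (9)] [cite: DuminilCopinSmirnov2012, Thm 1] -/
theorem exists_hasConnectiveConstant_martini :
    ∃ μM : ℝ, 0 < μM ∧ HasConnectiveConstant martiniGraph μM ∧
      (Real.sqrt (2 + Real.sqrt 2))⁻¹ ^ 2 = μM⁻¹ ^ 3 + μM⁻¹ ^ 4 := by
  obtain ⟨x₀, hx0, hx1, hroot⟩ := exists_root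
  refine ⟨x₀⁻¹, inv_pos.2 hx0, fun p => tendsto_sawCount_rpow hx0 hx1 hroot p, ?_⟩
  rw [inv_inv, hroot, ← hexConnectiveConstant_eq_of_thm1 DuminilCopinSmirnov2012_thm1_holds, inv_pow]

/-- The same with the tree's `μ(ℍ)`: `μ̃⁻³ + μ̃⁻⁴ = μ(ℍ)⁻²` (no Duminil-Copin–Smirnov needed). [cite: GrimmettLi2013Fisher, Theorem 3(a)] -/
theorem martini_relation :
    ∃ μM : ℝ, 0 < μM ∧ HasConnectiveConstant martiniGraph μM ∧ μM⁻¹ ^ 3 + μM⁻¹ ^ 4 = (hexConnectiveConstant ^ 2)⁻¹ := by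
  obtain ⟨x₀, hx0, hx1, hroot⟩ := exists_root
  exact ⟨x₀⁻¹, inv_pos.2 hx0, fun p => tendsto_sawCount_rpow hx0 hx1 hroot p, by rw [inv_inv, hroot]⟩

/-- The connective constant of `ℍ̃` in the sense (2.1) is unique. [cite: GrimmettLi2013Fisher, §2 eq. (2.1)] -/
theorem martini_unique {μ μ' : ℝ} (h : HasConnectiveConstant martiniGraph μ)
    (h' : HasConnectiveConstant martiniGraph μ') : μ = μ' :=
  h.unique mW h'

end Analysis

end Literature.Probability.RandomPlanarGeometry.SAW
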